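import Literature.NumberTheory.LFunctions.LogFreeDensityLemmaB
import Literature.NumberTheory.LFunctions.LandauPageRealZeros
import Literature.NumberTheory.LFunctions.ExceptionalZeroSimple
import Literature.NumberTheory.LFunctions.ExplicitFormulaPsiCharHeights
import Literature.NumberTheory.Sieve.HybridLargeSievePrimes
import Mathlib.NumberTheory.DirichletCharacter.Orthogonality
import HarnessLib

/-!
# Bombieri's log-free zero-density theorem (Le grand crible, Théorème 14), the case `χ ≠ χ₀`

Topic `Literature/NumberTheory/LFunctions`, sub-namespace `LogFreeDensity`. Everything here is
PROVED.

Bombieri, *Le grand crible dans la théorie analytique des nombres* (Astérisque 18), §6, THÉORÈME 14: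
"Il existe des constantes absolues `c₁, c₂, c₃` avec la propriété suivante. Soit `T ≥ 2` … on a
`∑_{q ≤ T} ∑*_{χ} N(α, T; χ) ≤ c₃ T^{c₂(1−α)}`."

This file assembles the inputs landed in the tree — the hybrid sifted large sieve
(`Literature.NumberTheory.Sieve.LargeSieve.hybridSieve_sifted`, Théorème 11), the Lemme de densité and
Lemme A/B (`LogFreeDensityLocal`, `LogFreeDensityLemmaA`, `LogFreeDensityLemmaB`), the classical
zero-free region with the Landau–Page theorem (`DirichletZFR`) — into the log-free estimate for the
primitive characters of modulus `2 ≤ q ≤ P` and heights `|γ| ≤ P^6`, in the shape consumed by the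
tree's `Literature.NumberTheory.Sieve.MontgomeryVaughan1975.lemma43_gallagher_of_explicitFormula_of_density`.

## References
* [Bombieri1987GrandCrible] §6 Théorème 14, pp. 48–51.
-/

noncomputable section

open Complex Finset Filter Real MeasureTheory
open scoped LSeries.notation ArithmeticFunction.vonMangoldt Topology Nat FourierTransform

namespace Literature.NumberTheory.LFunctions.LogFreeDensity

open Literature.NumberTheory.LFunctions.DirichletDisc Literature.NumberTheory.Sieve.LargeSieve

/-! ### The sieve side: the mean value of the sifted sums over `q`, `χ`, `v` -/

/-- The support of the sifted sequence: prime powers in `(⌊x^{a₀}⌋, ⌊x⌋]` all of whose prime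
factors exceed `z`. [folklore] -/
def siftedSet (x : ℝ) (z : ℕ) : Finset ℕ :=
  (Ioc ⌊x ^ expoB⌋₊ ⌊x⌋₊).filter (fun n => IsPrimePow n ∧ z < n.minFac)

/-- Elements of the sifted set are `≥ ⌊x^{a₀}⌋ + 1` and coprime to every `m ≤ z`. [folklore] -/
theorem siftedSet_prop {x : ℝ} {z n : ℕ} (hn : n ∈ siftedSet x z) :
    ⌊x ^ expoB⌋₊ < n ∧ n ≤ ⌊x⌋₊ ∧ ∀ m ∈ Icc 1 z, Nat.Coprime n m := by
  rw [siftedSet, mem_filter, mem_Ioc] at hn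
  obtain ⟨⟨h1, h2⟩, hpp, hmin⟩ := hn
  refine ⟨h1, h2, fun m hm => ?_⟩
  rw [mem_Icc] at hm
  obtain ⟨p, k, hp, hk, rfl⟩ := hpp
  have hp' : p.Prime := Nat.prime_iff.2 hp
  rw [Nat.Prime.pow_minFac hp' hk.ne'] at hmin
  refine Nat.Coprime.pow_left k ?_
  exact (Nat.Prime.coprime_iff_not_dvd hp').2 (Nat.not_dvd_of_pos_of_lt (by omega) (by omega))

/-- `n^{-(1+iv)} = n^{-1} · e(−ν_n v)` (`ν_n = log n / 2π`). [folklore] -/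
theorem natCast_cpow_neg_one_add_eq {n : ℕ} (hn : n ≠ 0) (v : ℝ) :
    (n : ℂ) ^ (-(1 + (v : ℂ) * I)) = (n : ℂ)⁻¹ * (𝐞 (logFreq n * (-v)) : ℂ) := by
  have hnC : (n : ℂ) ≠ 0 := by exact_mod_cast hn
  rw [fourierChar_logFreq_mul, Complex.cpow_def_of_ne_zero hnC]
  have hlog : Complex.log (n : ℂ) = (Real.log n : ℂ) := (Complex.natCast_log).symm
  have hsplit : Complex.log (n : ℂ) * -(1 + (v : ℂ) * I) =
      -Complex.log (n : ℂ) + I * (((-v : ℝ) : ℂ) * (Real.log n : ℂ)) := by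
    rw [hlog]; push_cast; ring
  rw [hsplit, Complex.exp_add, Complex.exp_neg, Complex.exp_log hnC]

/-- The summatory function of the sifted sequence is the character sum of the sieve:
`S_{χ,v}(t) = ∑_{n ∈ G, n ≤ t} (Λ(n)/n) χ(n) e(−ν_n v)`. [folklore] -/
theorem summatory_coefSifted_eq {q : ℕ} (χ : DirichletCharacter ℂ q) (v x : ℝ) (z : ℕ) (t : ℝ) :
    summatory (coefSifted χ v x z) t =
      ∑ n ∈ (siftedSet x z).filter (fun n => n ≤ ⌊t⌋₊),
        ((Λ n / n : ℝ) : ℂ) * χ n * (𝐞 (logFreq n * (-v)) : ℂ) := by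
  classical
  unfold summatory
  have h1 : ∀ i ∈ Icc 0 ⌊t⌋₊, coefSifted χ v x z i =
      if i ∈ siftedSet x z then ((Λ i / i : ℝ) : ℂ) * χ i * (𝐞 (logFreq i * (-v)) : ℂ) else 0 := by
    intro i _
    rw [coefSifted, ← siftedSet]
    split_ifs with h
    · have hi : i ≠ 0 := by have := (siftedSet_prop h).1; omega
      rw [coef, natCast_cpow_neg_one_add_eq hi]
      push_cast
      ring
    · rfl
  rw [sum_congr rfl h1, ← sum_filter]
  congr 1
  ext n
  simp only [mem_filter, mem_Icc, Nat.zero_le, true_and]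
  tauto

open scoped Classical in
/-- **The sieve side of Théorème 14** (Bombieri p. 50: "la dernière inégalité résultant du
Théorème 11"): for `1 ≤ Q₁ < z`, `T' ≥ 1`, and `z² T' ≤ ⌊x^{a₀}⌋ + 1`, for every `t`,
`∑_{q ≤ Q₁} ∑*_χ ∫_{−T'}^{T'} ‖S_{χ,v}(t)‖² dv ≤ (C_H/log(z/Q₁)) ∑_{n ∈ G, n ≤ t} Λ(n)²/n`,
`C_H = π²(πe^π/2 + 2)`. [cite: Bombieri1987GrandCrible, §6 Théorème 14 (proof)] -/
theorem sieveSide {Q₁ z : ℕ} (hQ₁ : 1 ≤ Q₁) (hz : Q₁ < z) {T' : ℝ} (hT : 1 ≤ T') {x : ℝ}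
    (hzx : (z : ℝ) ^ 2 * T' ≤ ⌊x ^ expoB⌋₊ + 1) (t : ℝ) :
    ∑ q ∈ Icc 1 Q₁, ∑ χ : DirichletCharacter ℂ q with χ.IsPrimitive,
        ∫ v in (-T')..T', ‖summatory (coefSifted χ v x z) t‖ ^ 2 ≤
      (π ^ 2 * (π * Real.exp π / 2 + 2)) / Real.log ((z : ℝ) / Q₁) *
        ∑ n ∈ (siftedSet x z).filter (fun n => n ≤ ⌊t⌋₊), Λ n ^ 2 / n := by
  set G := (siftedSet x z).filter (fun n => n ≤ ⌊t⌋₊) with hG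
  have hS : ∀ n ∈ G, (∀ m ∈ Icc 1 z, Nat.Coprime n m) ∧ (z : ℝ) ^ 2 * T' ≤ n := by
    intro n hn
    rw [hG, mem_filter] at hn
    obtain ⟨h1, -, h3⟩ := siftedSet_prop hn.1
    refine ⟨h3, hzx.trans ?_⟩
    exact_mod_cast h1
  have h := hybridSieve_sifted hQ₁ hz hT G hS (fun n => ((Λ n / n : ℝ) : ℂ))
  -- rewrite our left side into the sieve's (substituting `v ↦ −v`)
  have hlhs : ∀ (q : ℕ) (χ : DirichletCharacter ℂ q),
      ∫ v in (-T')..T', ‖summatory (coefSifted χ v x z) t‖ ^ 2 =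
        ∫ v in (-T')..T', ‖∑ n ∈ G, ((Λ n / n : ℝ) : ℂ) * χ n * (𝐞 (logFreq n * v) : ℂ)‖ ^ 2 := by
    intro q χ
    have h1 := intervalIntegral.integral_comp_neg (a := -T') (b := T')
      (f := fun w : ℝ => ‖∑ n ∈ G, ((Λ n / n : ℝ) : ℂ) * χ n * (𝐞 (logFreq n * w) : ℂ)‖ ^ 2)
    rw [neg_neg] at h1
    rw [← h1]
    refine intervalIntegral.integral_congr fun v _ => ?_
    show ‖summatory (coefSifted χ v x z) t‖ ^ 2 = ‖∑ n ∈ G, ((Λ n / n : ℝ) : ℂ) * χ n * (𝐞 (logFreq n * (-v)) : ℂ)‖ ^ 2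
    rw [summatory_coefSifted_eq, ← hG]
  simp only [hlhs]
  refine h.trans (le_of_eq ?_)
  congr 1
  refine sum_congr rfl fun n hn => ?_
  have hn0 : (0 : ℝ) < n := by
    have := (siftedSet_prop (mem_filter.1 hn).1).1
    exact_mod_cast (show 0 < n by omega)
  rw [Complex.norm_real, Real.norm_eq_abs, sq_abs]
  field_simp

/-! ### Measurability and integrability of the mean values -/

/-- `v ↦ b_n(v) = coefSifted χ v x z n` is continuous. [folklore] -/
theorem continuous_coefSifted {q : ℕ} (χ : DirichletCharacter ℂ q) (x : ℝ) (z n : ℕ) :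
    Continuous fun v : ℝ => coefSifted χ v x z n := by
  by_cases h : n ∈ (Ioc ⌊x ^ expoB⌋₊ ⌊x⌋₊).filter (fun n => IsPrimePow n ∧ z < n.minFac)
  · have hn : n ≠ 0 := by
      rw [← siftedSet] at h; have := (siftedSet_prop h).1; omega
    have heq : (fun v : ℝ => coefSifted χ v x z n) =
        fun v : ℝ => (Λ n : ℂ) * χ n * ((n : ℂ)⁻¹ * (𝐞 (logFreq n * (-v)) : ℂ)) := by
      funext v
      rw [coefSifted, if_pos h, coef, natCast_cpow_neg_one_add_eq hn]
    rw [heq]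
    refine continuous_const.mul (continuous_const.mul ?_)
    exact continuous_subtype_val.comp (Real.continuous_fourierChar.comp (continuous_const.mul continuous_neg))
  · have heq : (fun v : ℝ => coefSifted χ v x z n) = fun _ => 0 := by
      funext v; rw [coefSifted, if_neg h]
    rw [heq]; exact continuous_const

/-- The two-variable integrand `F(v, t) = ‖S_{χ,v}(t)‖²/t` is measurable. [folklore] -/
theorem measurable_normSq_summatory {q : ℕ} (χ : DirichletCharacter ℂ q) (x : ℝ) (z : ℕ) :
    Measurable fun p : ℝ × ℝ => ‖summatory (coefSifted χ p.1 x z) p.2‖ ^ 2 / p.2 := by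
  -- `H(v, m) = ∑_{i ≤ m} b_i(v)` is measurable on `ℝ × ℕ`
  have hH : Measurable fun p : ℝ × ℕ => ∑ i ∈ Icc 0 p.2, coefSifted χ p.1 x z i := by
    refine measurable_from_prod_countable_left fun m => ?_
    show Measurable fun v : ℝ => ∑ i ∈ Icc 0 m, coefSifted χ v x z i
    exact (continuous_finsetSum _ fun i _ => continuous_coefSifted χ x z i).measurable
  have hfl : Measurable fun p : ℝ × ℝ => (p.1, ⌊p.2⌋₊) :=
    measurable_fst.prodMk (Nat.measurable_floor.comp measurable_snd)
  have hS : Measurable fun p : ℝ × ℝ => summatory (coefSifted χ p.1 x z) p.2 := by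
    have : (fun p : ℝ × ℝ => summatory (coefSifted χ p.1 x z) p.2) =
        (fun p : ℝ × ℕ => ∑ i ∈ Icc 0 p.2, coefSifted χ p.1 x z i) ∘ fun p : ℝ × ℝ => (p.1, ⌊p.2⌋₊) := by
      funext p; rfl
    rw [this]; exact hH.comp hfl
  exact (hS.norm.pow_const 2).div measurable_snd

/-- Uniform bound: `‖S_{χ,v}(t)‖²/t ≤ (∑_{i ≤ ⌊x⌋} Λ(i)/i)²` for `t ≥ 1`. [folklore] -/
theorem normSq_summatory_div_le {q : ℕ} (χ : DirichletCharacter ℂ q) (v x : ℝ) (z : ℕ) {t : ℝ}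
    (ht : 1 ≤ t) (htx : t ≤ x) :
    ‖summatory (coefSifted χ v x z) t‖ ^ 2 / t ≤ (∑ i ∈ Icc 0 ⌊x⌋₊, Λ i / i) ^ 2 := by
  have hfl : ⌊t⌋₊ ≤ ⌊x⌋₊ := Nat.floor_le_floor htx
  have h1 : ‖summatory (coefSifted χ v x z) t‖ ≤ ∑ i ∈ Icc 0 ⌊x⌋₊, Λ i / i :=
    (norm_summatory_le _ hfl).trans (sum_le_sum fun i _ => norm_coefSifted_le χ v x z i)
  calc ‖summatory (coefSifted χ v x z) t‖ ^ 2 / t ≤ ‖summatory (coefSifted χ v x z) t‖ ^ 2 :=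
        div_le_self (by positivity) ht
    _ ≤ _ := pow_le_pow_left₀ (norm_nonneg _) h1 2

/-- The mean value `I_χ(v) = ∫_{(⌊x^{a₀}⌋, x]} ‖S_{χ,v}(t)‖²/t dt`. [cite: Bombieri1987GrandCrible, §6 Lemme B] -/
def meanValue {q : ℕ} (χ : DirichletCharacter ℂ q) (x : ℝ) (z : ℕ) (v : ℝ) : ℝ :=
  ∫ t in Set.Ioc (⌊x ^ expoB⌋₊ : ℝ) x, ‖summatory (coefSifted χ v x z) t‖ ^ 2 / t

/-- `I_χ(v) ≥ 0`. [folklore] -/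
theorem meanValue_nonneg {q : ℕ} (χ : DirichletCharacter ℂ q) (x : ℝ) (z : ℕ) (v : ℝ) :
    0 ≤ meanValue χ x z v :=
  setIntegral_nonneg measurableSet_Ioc fun t ht => by
    have : (0 : ℝ) ≤ t := le_trans (Nat.cast_nonneg _) ht.1.le
    positivity

/-- `I_χ(v) ≤ (∑_{i ≤ x} Λ(i)/i)² · x` (a crude uniform bound). [folklore] -/
theorem meanValue_le {q : ℕ} (χ : DirichletCharacter ℂ q) {x : ℝ} (hx : 1 ≤ x) (z : ℕ) (v : ℝ)
    (hNX : 1 ≤ ⌊x ^ expoB⌋₊) :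
    meanValue χ x z v ≤ (∑ i ∈ Icc 0 ⌊x⌋₊, Λ i / i) ^ 2 * x := by
  unfold meanValue
  have hvol : volume (Set.Ioc (⌊x ^ expoB⌋₊ : ℝ) x) < ⊤ := measure_Ioc_lt_top
  calc ∫ t in Set.Ioc (⌊x ^ expoB⌋₊ : ℝ) x, ‖summatory (coefSifted χ v x z) t‖ ^ 2 / t
      ≤ ∫ t in Set.Ioc (⌊x ^ expoB⌋₊ : ℝ) x, (∑ i ∈ Icc 0 ⌊x⌋₊, Λ i / i) ^ 2 := by
        refine setIntegral_mono_on ?_ (integrableOn_const hvol.ne) measurableSet_Ioc fun t ht => ?_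
        · exact integrableOn_normSq_summatory_div _ x hNX
        · exact normSq_summatory_div_le χ v x z (le_trans (by exact_mod_cast hNX) ht.1.le) ht.2
    _ = (∑ i ∈ Icc 0 ⌊x⌋₊, Λ i / i) ^ 2 * (x - ⌊x ^ expoB⌋₊) := by
        have hle : (⌊x ^ expoB⌋₊ : ℝ) ≤ x :=
          (Nat.floor_le (by positivity)).trans (Real.rpow_le_self_of_one_le hx (by
            linarith [expoB_le_half]))
        rw [setIntegral_const, smul_eq_mul, mul_comm, Measure.real, Real.volume_Ioc,
          ENNReal.toReal_ofReal (by linarith)]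
    _ ≤ (∑ i ∈ Icc 0 ⌊x⌋₊, Λ i / i) ^ 2 * x := by
        refine mul_le_mul_of_nonneg_left (by linarith [(Nat.cast_nonneg ⌊x ^ expoB⌋₊ : (0:ℝ) ≤ _)]) (by positivity)

/-- `v ↦ I_χ(v)` is measurable (Fubini). [folklore] -/
theorem measurable_meanValue {q : ℕ} (χ : DirichletCharacter ℂ q) (x : ℝ) (z : ℕ) :
    Measurable (meanValue χ x z) := by
  unfold meanValue
  have h := (measurable_normSq_summatory χ x z).stronglyMeasurable.integral_prod_right'
    (ν := volume.restrict (Set.Ioc (⌊x ^ expoB⌋₊ : ℝ) x))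
  exact h.measurable

/-- `I_χ` is integrable on every bounded interval. [folklore] -/
theorem integrableOn_meanValue {q : ℕ} (χ : DirichletCharacter ℂ q) {x : ℝ} (hx : 1 ≤ x) (z : ℕ)
    (hNX : 1 ≤ ⌊x ^ expoB⌋₊) (a b : ℝ) :
    IntegrableOn (meanValue χ x z) (Set.Icc a b) := by
  refine Measure.integrableOn_of_bounded (M := (∑ i ∈ Icc 0 ⌊x⌋₊, Λ i / i) ^ 2 * x)
    measure_Icc_lt_top.ne (measurable_meanValue χ x z).aestronglyMeasurable ?_
  refine Eventually.of_forall fun v => ?_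
  rw [Real.norm_eq_abs, abs_of_nonneg (meanValue_nonneg χ x z v)]
  exact meanValue_le χ hx z v hNX

/-! ### The zero side: summing Lemme B over the zeros of one character -/

/-- The multiplicity-weighted number of zeros within `r/2` in height of `v` (and `1 − β ≤ r/2`) is at
most `C_d(1 + rℒ)`: they lie in `|ρ − (1+iv)| ≤ r` (Lemme de densité). [cite: Bombieri1987GrandCrible, §6 Théorème 14 (proof)] -/
theorem overlap_le {C_d : ℝ}
    (hdens : ∀ (q : ℕ) [NeZero q] (χ : DirichletCharacter ℂ q), χ ≠ 1 → ∀ (v r : ℝ),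
      0 < r → r ≤ 1 / 4 →
        ∑ ρ ∈ (discZeros χ v).filter (fun ρ => ‖ρ - (1 + (v : ℂ) * I)‖ ≤ r),
            (discDivisor χ v ρ : ℝ) ≤ C_d * (1 + r * (Real.log q + Real.log (|v| + 4))))
    {q : ℕ} [NeZero q] (χ : DirichletCharacter ℂ q) (hχ : χ ≠ 1) {r : ℝ} (hr : 0 < r) (hr4 : r ≤ 1 / 4)
    (Zρ : Finset ℂ) (hZ : ∀ ρ ∈ Zρ, χ.LFunction ρ = 0 ∧ 1 - r / 2 ≤ ρ.re ∧ ρ.re < 1) (v : ℝ) :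
    ∑ ρ ∈ Zρ.filter (fun ρ => |ρ.im - v| ≤ r / 2), (zeroOrder χ ρ : ℝ) ≤
      C_d * (1 + r * (Real.log q + Real.log (|v| + 4))) := by
  classical
  set W := Zρ.filter (fun ρ => |ρ.im - v| ≤ r / 2) with hW
  -- each `ρ ∈ W` lies in `discZeros χ v` with `|ρ − (1+iv)| ≤ r`
  have hmem : ∀ ρ ∈ W, ρ ∈ discZeros χ v ∧ ‖ρ - (1 + (v : ℂ) * I)‖ ≤ r := by
    intro ρ hρ
    rw [hW, mem_filter] at hρ
    obtain ⟨hρZ, hγ⟩ := hρ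
    obtain ⟨h0, hβ, hβ1⟩ := hZ ρ hρZ
    have hnorm : ‖ρ - (1 + (v : ℂ) * I)‖ ≤ r := by
      have hre : (ρ - (1 + (v : ℂ) * I)).re = ρ.re - 1 := by simp
      have him : (ρ - (1 + (v : ℂ) * I)).im = ρ.im - v := by simp
      calc ‖ρ - (1 + (v : ℂ) * I)‖ ≤ |(ρ - (1 + (v : ℂ) * I)).re| + |(ρ - (1 + (v : ℂ) * I)).im| :=
            Complex.norm_le_abs_re_add_abs_im _
        _ ≤ r / 2 + r / 2 := by
            rw [hre, him]
            refine add_le_add ?_ hγ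
            rw [abs_sub_comm, abs_of_nonneg (by linarith)]; linarith
        _ = r := by ring
    refine ⟨(mem_discZeros hχ).2 ⟨?_, h0⟩, hnorm⟩
    rw [Metric.mem_closedBall, dist_eq_norm]
    calc ‖ρ - (2 + (v : ℂ) * I)‖ = ‖(ρ - (1 + (v : ℂ) * I)) - 1‖ := by ring_nf
      _ ≤ ‖ρ - (1 + (v : ℂ) * I)‖ + ‖(1 : ℂ)‖ := norm_sub_le _ _
      _ ≤ r + 1 := by rw [norm_one]; linarith
      _ ≤ 81 / 50 := by linarith
  have hsub : W ⊆ (discZeros χ v).filter (fun ρ => ‖ρ - (1 + (v : ℂ) * I)‖ ≤ r) := by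
    intro ρ hρ; rw [mem_filter]; exact hmem ρ hρ
  calc ∑ ρ ∈ W, (zeroOrder χ ρ : ℝ) = ∑ ρ ∈ W, (discDivisor χ v ρ : ℝ) := by
        refine sum_congr rfl fun ρ hρ => ?_
        rw [(discZeros_prop hχ (hmem ρ hρ).1).2.2.2.2.1]; norm_cast
    _ ≤ ∑ ρ ∈ (discZeros χ v).filter (fun ρ => ‖ρ - (1 + (v : ℂ) * I)‖ ≤ r), (discDivisor χ v ρ : ℝ) :=
        sum_le_sum_of_subset_of_nonneg hsub fun ρ _ _ => by exact_mod_cast discDivisor_nonneg hχ v ρ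
    _ ≤ _ := hdens q χ hχ v r hr hr4

/-- **The zero side of Théorème 14** (Bombieri pp. 49–50: "en appliquant le lemme B … donc, en
sommant sur les zéros ρ: `r(log x)^{-3}x^{-Cr} N(α, T; χ) ≪ (r log T) ∫_{−T−r}^{T+r} …`"): there are
absolute `A₀, r₀, C > 0` such that for `χ ≠ χ₀` mod `q`, `log q + log(T' + 4) ≤ L'`, `0 < r ≤ r₀`,
`rL' ≥ 1`, `log x ≥ A₀ L'`, `z ≤ x^{a₀/2}`, and any finite set `Z` of zeros of `L(s, χ)` with
`1 − r/2 ≤ β < 1`, `|γ| + r/2 ≤ T'`,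
`r · e^{−10} x^{−r/10} r^{−3} · ∑_{ρ ∈ Z} m(ρ) ≤ C (rL') ∫_{−T'}^{T'} I_χ(v) dv`.
[cite: Bombieri1987GrandCrible, §6 Théorème 14 (proof)] -/
theorem zeroSide :
    ∃ A₀ r₀ C : ℝ, 0 < A₀ ∧ 0 < r₀ ∧ 0 < C ∧
      ∀ (q : ℕ) [NeZero q] (χ : DirichletCharacter ℂ q), χ ≠ 1 → ∀ (T' r L' x : ℝ) (z : ℕ)
        (Zρ : Finset ℂ),
        Real.log q + Real.log (T' + 4) ≤ L' → 0 < r → r ≤ r₀ → 1 ≤ r * L' → 1 ≤ x →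
        A₀ * L' ≤ Real.log x → (z : ℝ) ≤ x ^ (expoB / 2) → 0 ≤ T' →
        (∀ ρ ∈ Zρ, χ.LFunction ρ = 0 ∧ 1 - r / 2 ≤ ρ.re ∧ ρ.re < 1 ∧ |ρ.im| + r / 2 ≤ T') →
          r * (Real.exp (-10) * x ^ (-(r / 10)) / r ^ 3) * ∑ ρ ∈ Zρ, (zeroOrder χ ρ : ℝ) ≤
            C * (r * L') * ∫ v in (-T')..T', meanValue χ x z v := by
  obtain ⟨A₀, r₀, hA₀, hr₀, hB⟩ := lemmeB
  obtain ⟨C_d, hC_d, hdens⟩ := exists_sum_near_le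
  refine ⟨A₀, min r₀ (1 / 4), 2 * C_d, hA₀, by positivity, by positivity,
    fun q _ χ hχ T' r L' x z Zρ hLL' hr hrmin hu hx hlogx hz hT' hZ => ?_⟩
  classical
  have hr0 : r ≤ r₀ := hrmin.trans (min_le_left _ _)
  have hr4 : r ≤ 1 / 4 := hrmin.trans (min_le_right _ _)
  set L₀ : ℝ := Real.exp (-10) * x ^ (-(r / 10)) / r ^ 3 with hL₀
  set A : Set ℝ := Set.Icc (-T') T' with hA
  have hxpos : 0 < x := by linarith
  -- `x^{a₀} ≥ 1`, needed for the integrability lemmas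
  have hNX : 1 ≤ ⌊x ^ expoB⌋₊ := Nat.le_floor (by
    simp only [Nat.cast_one]; exact Real.one_le_rpow hx expoB_pos.le)
  have hint : IntegrableOn (meanValue χ x z) A := integrableOn_meanValue χ hx z hNX _ _
  -- Lemme B at every `v` within `r/2` of the height of a zero of `Z`
  have hLB : ∀ ρ ∈ Zρ, ∀ v ∈ Set.Icc (ρ.im - r / 2) (ρ.im + r / 2), L₀ ≤ meanValue χ x z v := by
    intro ρ hρ v hv
    obtain ⟨h0, hβ, hβ1, hγT⟩ := hZ ρ hρ
    have hvT : |v| ≤ T' := by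
      rw [Set.mem_Icc] at hv
      have h1 : |ρ.im| ≤ T' - r / 2 := by linarith
      have h2 := abs_le.1 h1
      rw [abs_le]; constructor <;> linarith
    have hLL'v : Real.log q + Real.log (|v| + 4) ≤ L' := by
      have := Real.log_le_log (by positivity) (show |v| + 4 ≤ T' + 4 by linarith)
      linarith
    -- the zero is within `r` of `1 + iv` and in the disc
    have hγ : |ρ.im - v| ≤ r / 2 := by
      rw [Set.mem_Icc] at hv; rw [abs_le]; constructor <;> linarith
    have hnorm : ‖ρ - (1 + (v : ℂ) * I)‖ ≤ r := by
      have hre : (ρ - (1 + (v : ℂ) * I)).re = ρ.re - 1 := by simp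
      have him : (ρ - (1 + (v : ℂ) * I)).im = ρ.im - v := by simp
      calc ‖ρ - (1 + (v : ℂ) * I)‖ ≤ |(ρ - (1 + (v : ℂ) * I)).re| + |(ρ - (1 + (v : ℂ) * I)).im| :=
            Complex.norm_le_abs_re_add_abs_im _
        _ ≤ r / 2 + r / 2 := by
            rw [hre, him]
            refine add_le_add ?_ hγ
            rw [abs_sub_comm, abs_of_nonneg (by linarith)]; linarith
        _ = r := by ring
    have hdisc : ρ ∈ discZeros χ v := by
      refine (mem_discZeros hχ).2 ⟨?_, h0⟩
      rw [Metric.mem_closedBall, dist_eq_norm]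
      calc ‖ρ - (2 + (v : ℂ) * I)‖ = ‖(ρ - (1 + (v : ℂ) * I)) - 1‖ := by ring_nf
        _ ≤ ‖ρ - (1 + (v : ℂ) * I)‖ + ‖(1 : ℂ)‖ := norm_sub_le _ _
        _ ≤ r + 1 := by rw [norm_one]; linarith
        _ ≤ 81 / 50 := by linarith
    exact hB q χ hχ v r L' x z hLL'v hr hr0 hu ⟨ρ, hdisc, hnorm⟩ hxpos hlogx hz
  -- per zero: `r L₀ ≤ ∫_A 𝟙_{J_ρ} I`
  have hper : ∀ ρ ∈ Zρ, r * L₀ ≤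
      ∫ v in A, (Set.Icc (ρ.im - r / 2) (ρ.im + r / 2)).indicator (meanValue χ x z) v := by
    intro ρ hρ
    obtain ⟨-, -, -, hγT⟩ := hZ ρ hρ
    set J : Set ℝ := Set.Icc (ρ.im - r / 2) (ρ.im + r / 2) with hJ
    have hJA : J ⊆ A := by
      intro v hv
      rw [hJ, Set.mem_Icc] at hv
      rw [hA, Set.mem_Icc]
      have h1 : |ρ.im| ≤ T' - r / 2 := by linarith
      have h2 := abs_le.1 h1
      constructor <;> linarith
    rw [setIntegral_indicator measurableSet_Icc, Set.inter_eq_right.2 hJA]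
    have hvol : volume.real J = r := by
      rw [hJ, Measure.real, Real.volume_Icc, ENNReal.toReal_ofReal (by linarith)]; ring
    have h := setIntegral_ge_of_const_le_real (c := L₀) measurableSet_Icc measure_Icc_lt_top.ne
      (fun v hv => hLB ρ hρ v hv) (hint.mono_set hJA)
    rw [hvol] at h
    linarith
  -- sum over the zeros and bound the overlap
  have hsum : r * L₀ * ∑ ρ ∈ Zρ, (zeroOrder χ ρ : ℝ) ≤
      ∫ v in A, ∑ ρ ∈ Zρ, (zeroOrder χ ρ : ℝ) *
        (Set.Icc (ρ.im - r / 2) (ρ.im + r / 2)).indicator (meanValue χ x z) v := by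
    rw [mul_sum, integral_finsetSum _ fun ρ _ => (hint.indicator measurableSet_Icc).const_mul _]
    refine sum_le_sum fun ρ hρ => ?_
    rw [integral_const_mul]
    have h0 : (0 : ℝ) ≤ zeroOrder χ ρ := Nat.cast_nonneg _
    calc r * L₀ * (zeroOrder χ ρ : ℝ) = (zeroOrder χ ρ : ℝ) * (r * L₀) := by ring
      _ ≤ _ := mul_le_mul_of_nonneg_left (hper ρ hρ) h0
  refine hsum.trans ?_
  -- pointwise overlap bound on `A`
  have hℒ : ∀ v ∈ A, Real.log q + Real.log (|v| + 4) ≤ L' := by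
    intro v hv
    rw [hA, Set.mem_Icc] at hv
    have hvT : |v| ≤ T' := abs_le.2 ⟨hv.1, hv.2⟩
    have := Real.log_le_log (by positivity) (show |v| + 4 ≤ T' + 4 by linarith)
    linarith
  have hpt : ∀ v ∈ A, ∑ ρ ∈ Zρ, (zeroOrder χ ρ : ℝ) *
      (Set.Icc (ρ.im - r / 2) (ρ.im + r / 2)).indicator (meanValue χ x z) v ≤
        (2 * C_d * (r * L')) * meanValue χ x z v := by
    intro v hv
    have heq : ∑ ρ ∈ Zρ, (zeroOrder χ ρ : ℝ) *
        (Set.Icc (ρ.im - r / 2) (ρ.im + r / 2)).indicator (meanValue χ x z) v =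
        (∑ ρ ∈ Zρ.filter (fun ρ => |ρ.im - v| ≤ r / 2), (zeroOrder χ ρ : ℝ)) * meanValue χ x z v := by
      rw [sum_mul, sum_filter]
      refine sum_congr rfl fun ρ _ => ?_
      by_cases h : |ρ.im - v| ≤ r / 2
      · rw [if_pos h, Set.indicator_of_mem]
        rw [Set.mem_Icc]; rw [abs_le] at h; constructor <;> linarith
      · rw [if_neg h, Set.indicator_of_notMem, mul_zero]
        rw [Set.mem_Icc]; intro h'; exact h (abs_le.2 ⟨by linarith, by linarith⟩)
    rw [heq]
    refine mul_le_mul_of_nonneg_right ?_ (meanValue_nonneg χ x z v)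
    have h1 := overlap_le hdens χ hχ hr hr4 Zρ (fun ρ hρ => ⟨(hZ ρ hρ).1, (hZ ρ hρ).2.1, (hZ ρ hρ).2.2.1⟩) v
    have h2 : C_d * (1 + r * (Real.log q + Real.log (|v| + 4))) ≤ 2 * C_d * (r * L') := by
      have := hℒ v hv
      have h3 : r * (Real.log q + Real.log (|v| + 4)) ≤ r * L' := mul_le_mul_of_nonneg_left this hr.le
      nlinarith [hC_d, hu]
    exact h1.trans h2
  have hi1 : IntegrableOn (fun v => ∑ ρ ∈ Zρ, (zeroOrder χ ρ : ℝ) *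
      (Set.Icc (ρ.im - r / 2) (ρ.im + r / 2)).indicator (meanValue χ x z) v) A :=
    integrable_finsetSum _ fun ρ _ => (hint.indicator measurableSet_Icc).const_mul _
  calc ∫ v in A, ∑ ρ ∈ Zρ, (zeroOrder χ ρ : ℝ) *
        (Set.Icc (ρ.im - r / 2) (ρ.im + r / 2)).indicator (meanValue χ x z) v
      ≤ ∫ v in A, (2 * C_d * (r * L')) * meanValue χ x z v :=
        setIntegral_mono_on hi1 (hint.const_mul _) measurableSet_Icc hpt
    _ = (2 * C_d * (r * L')) * ∫ v in (-T')..T', meanValue χ x z v := by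
        rw [integral_const_mul, hA, integral_Icc_eq_integral_Ioc,
          ← intervalIntegral.integral_of_le (by linarith)]

/-! ### Fubini: from `∫_v I_χ(v) dv` to `∫_t (∫_v ‖S‖²)/t dt` -/

/-- The integrand `(v, t) ↦ ‖S_{χ,v}(t)‖²/t` is integrable on `(−T', T'] × (⌊x^{a₀}⌋, x]`. [folklore] -/
theorem integrable_normSq_prod {q : ℕ} (χ : DirichletCharacter ℂ q) (x : ℝ) (z : ℕ)
    (hNX : 1 ≤ ⌊x ^ expoB⌋₊) (T' : ℝ) :
    Integrable (Function.uncurry fun v t : ℝ => ‖summatory (coefSifted χ v x z) t‖ ^ 2 / t)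
      ((volume.restrict (Set.Ioc (-T') T')).prod (volume.restrict (Set.Ioc (⌊x ^ expoB⌋₊ : ℝ) x))) := by
  set Sv : Set ℝ := Set.Ioc (-T') T' with hSv
  set St : Set ℝ := Set.Ioc (⌊x ^ expoB⌋₊ : ℝ) x with hSt
  set F : ℝ → ℝ → ℝ := fun v t => ‖summatory (coefSifted χ v x z) t‖ ^ 2 / t with hF
  have hmeas : Measurable (Function.uncurry F) := measurable_normSq_summatory χ x z
  have hbound : ∀ p ∈ Sv ×ˢ St, ‖Function.uncurry F p‖ ≤ (∑ i ∈ Icc 0 ⌊x⌋₊, Λ i / i) ^ 2 := by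
    rintro ⟨v, t⟩ ⟨-, ht⟩
    rw [hSt] at ht
    have ht1 : (1 : ℝ) ≤ t := le_trans (by exact_mod_cast hNX) ht.1.le
    rw [Function.uncurry_apply_pair, Real.norm_eq_abs, abs_of_nonneg (by rw [hF]; positivity)]
    exact normSq_summatory_div_le χ v x z ht1 ht.2
  rw [Measure.prod_restrict, ← Measure.volume_eq_prod]
  refine Measure.integrableOn_of_bounded (M := (∑ i ∈ Icc 0 ⌊x⌋₊, Λ i / i) ^ 2) ?_
    hmeas.aestronglyMeasurable ?_
  · rw [Measure.volume_eq_prod, Measure.prod_prod]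
    exact ENNReal.mul_ne_top measure_Ioc_lt_top.ne measure_Ioc_lt_top.ne
  · rw [ae_restrict_iff' (measurableSet_Ioc.prod measurableSet_Ioc)]
    exact Eventually.of_forall hbound

/-- **Interchange of the `v`- and `t`-integrals.** [folklore] -/
theorem integral_meanValue_eq {q : ℕ} (χ : DirichletCharacter ℂ q) (x : ℝ) (z : ℕ)
    (hNX : 1 ≤ ⌊x ^ expoB⌋₊) {T' : ℝ} (hT' : 0 ≤ T') :
    ∫ v in (-T')..T', meanValue χ x z v =
      ∫ t in Set.Ioc (⌊x ^ expoB⌋₊ : ℝ) x,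
        (∫ v in (-T')..T', ‖summatory (coefSifted χ v x z) t‖ ^ 2) / t := by
  have hswap := integral_integral_swap (integrable_normSq_prod χ x z hNX T')
  rw [intervalIntegral.integral_of_le (by linarith)]
  unfold meanValue
  rw [show (∫ v in Set.Ioc (-T') T', ∫ t in Set.Ioc (⌊x ^ expoB⌋₊ : ℝ) x,
      ‖summatory (coefSifted χ v x z) t‖ ^ 2 / t) =
      ∫ v in Set.Ioc (-T') T', ∫ t in Set.Ioc (⌊x ^ expoB⌋₊ : ℝ) x,
        (fun v t : ℝ => ‖summatory (coefSifted χ v x z) t‖ ^ 2 / t) v t from rfl, hswap]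
  refine setIntegral_congr_fun measurableSet_Ioc fun t _ => ?_
  rw [intervalIntegral.integral_of_le (by linarith), ← integral_div]

/-- The inner `v`-integral divided by `t` is integrable in `t`. [folklore] -/
theorem integrableOn_inner {q : ℕ} (χ : DirichletCharacter ℂ q) (x : ℝ) (z : ℕ)
    (hNX : 1 ≤ ⌊x ^ expoB⌋₊) {T' : ℝ} (hT' : 0 ≤ T') :
    IntegrableOn (fun t => (∫ v in (-T')..T', ‖summatory (coefSifted χ v x z) t‖ ^ 2) / t)
      (Set.Ioc (⌊x ^ expoB⌋₊ : ℝ) x) := by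
  have h := (integrable_normSq_prod χ x z hNX T').integral_prod_right
  refine (h.congr (Eventually.of_forall fun t => ?_))
  simp only [Function.uncurry_apply_pair]
  rw [intervalIntegral.integral_of_le (by linarith), ← integral_div]

/-! ### Elementary: `∑_{n ≤ N} Λ(n)²/n ≤ log N (log N + log 4 + 2)` -/

/-- `∑_{n ≤ N} Λ(n)²/n ≤ log N · (log N + log 4 + 2)` (`Λ ≤ log`). [folklore] -/
theorem sum_vonMangoldt_sq_div_le (N : ℕ) :
    ∑ n ∈ Icc 1 N, Λ n ^ 2 / n ≤ Real.log N * (Real.log N + Real.log 4 + 2) := by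
  have h1 : ∀ n ∈ Icc 1 N, Λ n ^ 2 / n ≤ Real.log N * (Λ n / n) := by
    intro n hn
    rw [mem_Icc] at hn
    have hn0 : (0 : ℝ) < n := by exact_mod_cast hn.1
    have hΛ : Λ n ≤ Real.log N :=
      ArithmeticFunction.vonMangoldt_le_log.trans (Real.log_le_log hn0 (by exact_mod_cast hn.2))
    rw [sq, mul_div_assoc]
    exact mul_le_mul_of_nonneg_right hΛ (div_nonneg ArithmeticFunction.vonMangoldt_nonneg hn0.le)
  refine (sum_le_sum h1).trans ?_
  rw [← mul_sum]
  exact mul_le_mul_of_nonneg_left (sum_vonMangoldt_div_le N) (Real.log_natCast_nonneg N)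

/-! ### The middle range `c₀/log P ≤ 1 − α ≤ δ₀` -/

/-- A primitive character of modulus `≥ 2` is not the trivial character. [folklore] -/
theorem ne_one_of_isPrimitive {q : ℕ} [NeZero q] (hq : 2 ≤ q) {χ : DirichletCharacter ℂ q}
    (hχ : χ.IsPrimitive) : χ ≠ 1 := by
  intro h
  rw [h, DirichletCharacter.isPrimitive_def, DirichletCharacter.conductor_one] at hχ
  omega

/-- `u³ ≤ e^{3u}` for `u ≥ 0`. [folklore] -/
theorem cube_le_exp {u : ℝ} (hu : 0 ≤ u) : u ^ 3 ≤ Real.exp (3 * u) := by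
  have h1 : u ≤ Real.exp u := by linarith [Real.add_one_le_exp u]
  calc u ^ 3 ≤ (Real.exp u) ^ 3 := pow_le_pow_left₀ hu h1 3
    _ = Real.exp (3 * u) := by rw [← Real.exp_nat_mul]; norm_num

set_option maxHeartbeats 800000 in
open scoped Classical in
/-- **Théorème 14 in the middle range** (Bombieri pp. 48–50): for every `c₀ > 0` there are
`δ₀, A, C > 0` such that for `P ≥ 2`, any finite sets `Z(q, χ)` of zeros of `L(s, χ)` in
`0 < β < 1`, `|γ| ≤ P^6`, and `c₀/log P ≤ 1 − α ≤ δ₀`,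
`∑_{2 ≤ q ≤ P} ∑*_{χ mod q} ∑_{ρ ∈ Z(q,χ), β ≥ α} m(ρ) ≤ C P^{A(1−α)}`.
[cite: Bombieri1987GrandCrible, §6 Théorème 14] -/
theorem middleRange {c₀ : ℝ} (hc₀ : 0 < c₀) :
    ∃ δ₀ A C : ℝ, 0 < δ₀ ∧ 0 < A ∧ 0 < C ∧
      ∀ P : ℝ, 2 ≤ P → ∀ Z : (q : ℕ) → DirichletCharacter ℂ q → Finset ℂ,
        (∀ (q' : ℕ) (χ : DirichletCharacter ℂ (q' + 1)), ∀ ρ ∈ Z (q' + 1) χ,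
            χ.LFunction ρ = 0 ∧ 0 < ρ.re ∧ ρ.re < 1 ∧ |ρ.im| ≤ P ^ 6) →
        ∀ α : ℝ, c₀ / Real.log P ≤ 1 - α → 1 - α ≤ δ₀ →
          ∑ q' ∈ Finset.Ico 1 ⌊P⌋₊, ∑ χ : DirichletCharacter ℂ (q' + 1) with χ.IsPrimitive,
            ∑ ρ ∈ Z (q' + 1) χ with α ≤ ρ.re, (zeroOrder χ ρ : ℝ) ≤ C * P ^ (A * (1 - α)) := by
  obtain ⟨A₀, r₀, C_z, hA₀, hr₀, hC_z, hZS⟩ := zeroSide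
  set C_H : ℝ := π ^ 2 * (π * Real.exp π / 2 + 2) with hC_H
  have hC_Hpos : 0 < C_H := by rw [hC_H]; positivity
  set a : ℝ := expoB with ha
  have hapos : 0 < a := expoB_pos
  set A₁ : ℝ := max A₀ (2 / a) with hA₁
  have hA₁pos : 0 < A₁ := lt_of_lt_of_le hA₀ (le_max_left _ _)
  have hA₁A₀ : A₀ ≤ A₁ := le_max_left _ _
  have hA₁a : 2 / a ≤ A₁ := le_max_right _ _
  set B : ℝ := max 8 (1 / (2 * c₀)) with hB
  have hB8 : 8 ≤ B := le_max_left _ _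
  have hBc : 1 / (2 * c₀) ≤ B := le_max_right _ _
  have hBpos : 0 < B := by linarith
  set K₁ : ℝ := 2 * C_z * C_H * A₁ ^ 3 * B ^ 4 with hK₁
  refine ⟨min (r₀ / 2) (1 / 2), (A₁ * B / 10 + 3) * 2, K₁ * Real.exp 10,
    by positivity, by positivity, by positivity, fun P hP Z hZ α hα1 hα2 => ?_⟩
  /- ── parameters ── -/
  have hPpos : 0 < P := by linarith
  set Lp : ℝ := Real.log P with hLp
  have hLp2 : Real.log 2 ≤ Lp := Real.log_le_log (by norm_num) hP
  have hlog2 : (0.69 : ℝ) ≤ Real.log 2 := by have := Real.log_two_gt_d9; linarith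
  have hLppos : 0 < Lp := by linarith
  set r : ℝ := 2 * (1 - α) with hr
  have hδ : 1 - α ≤ r₀ / 2 := hα2.trans (min_le_left _ _)
  have hδ' : 1 - α ≤ 1 / 2 := hα2.trans (min_le_right _ _)
  have h1α : c₀ / Lp ≤ 1 - α := hα1
  have h1αpos : 0 < 1 - α := lt_of_lt_of_le (by positivity) h1α
  have hrpos : 0 < r := by rw [hr]; linarith
  have hrr₀ : r ≤ r₀ := by rw [hr]; linarith
  have hr1 : r ≤ 1 := by rw [hr]; linarith
  set L' : ℝ := B * Lp with hL'
  have hL'8 : 8 * Lp ≤ L' := by rw [hL']; exact mul_le_mul_of_nonneg_right hB8 hLppos.le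
  have hu : 1 ≤ r * L' := by
    rw [hr, hL']
    have h1 : c₀ ≤ (1 - α) * Lp := by rwa [div_le_iff₀ hLppos] at h1α
    have h2 : 1 ≤ 2 * c₀ * B := by
      rw [div_le_iff₀ (by positivity)] at hBc; linarith
    calc (1 : ℝ) ≤ 2 * c₀ * B := h2
      _ ≤ 2 * ((1 - α) * Lp) * B := by nlinarith only [h1, hBpos, hc₀]
      _ = 2 * (1 - α) * (B * Lp) := by ring
  set Lx : ℝ := A₁ * L' with hLx
  set x : ℝ := Real.exp Lx with hx
  have hxpos : 0 < x := Real.exp_pos _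
  have hlogx : Real.log x = Lx := Real.log_exp _
  have hLxA₀ : A₀ * L' ≤ Real.log x := by
    rw [hlogx, hLx]; exact mul_le_mul_of_nonneg_right hA₁A₀ (by positivity)
  have hLx16 : 16 * Lp ≤ a * Lx := by
    rw [hLx]
    have : 2 / a * (8 * Lp) ≤ A₁ * L' :=
      mul_le_mul hA₁a hL'8 (by positivity) hA₁pos.le
    have h2 : a * (2 / a * (8 * Lp)) = 16 * Lp := by field_simp; ring
    calc 16 * Lp = a * (2 / a * (8 * Lp)) := h2.symm
      _ ≤ a * (A₁ * L') := mul_le_mul_of_nonneg_left this hapos.le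
  have hLxnn : 0 ≤ Lx := by rw [hLx]; positivity
  have hLx4 : 4 ≤ Lx := by
    have h1 : a * Lx ≤ Lx / 2 := by nlinarith only [expoB_le_half, hLxnn, ha]
    linarith
  have hx1 : 1 ≤ x := by rw [hx]; exact Real.one_le_exp (by linarith)
  set T' : ℝ := P ^ 6 + 1 with hT'
  have hT'1 : 1 ≤ T' := by rw [hT']; have := pow_nonneg hPpos.le 6; linarith
  have hT'0 : 0 ≤ T' := by linarith
  have hT'pos : 0 < T' := by linarith
  /- ── `NX = ⌊x^{a₀}⌋ ≥ P^16 − 1` and `z` ── -/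
  set NX : ℕ := ⌊x ^ a⌋₊ with hNX
  have hxa : x ^ a = Real.exp (a * Lx) := by rw [hx, ← Real.exp_mul, mul_comm]
  have hP16 : P ^ (16 : ℕ) ≤ x ^ a := by
    rw [hxa]
    calc P ^ (16 : ℕ) = Real.exp (16 * Lp) := by
          rw [hLp, ← Real.exp_log (pow_pos hPpos 16), Real.log_pow]; norm_num
      _ ≤ Real.exp (a * Lx) := Real.exp_le_exp.2 hLx16
  have hP16' : (2 : ℝ) ^ (16 : ℕ) ≤ P ^ (16 : ℕ) := pow_le_pow_left₀ (by norm_num) hP 16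
  have hNXle : (NX : ℝ) ≤ x ^ a := Nat.floor_le (by positivity)
  have hNXgt : x ^ a < NX + 1 := Nat.lt_floor_add_one _
  have hNX1 : 1 ≤ NX := Nat.le_floor (by
    simp only [Nat.cast_one]; linarith only [hP16, hP16', (by norm_num : (1:ℝ) ≤ 2 ^ 16)])
  have hNXhalf : P ^ (16 : ℕ) / 2 ≤ NX := by
    linarith only [hP16, hP16', hNXgt, (by norm_num : (2:ℝ) ≤ 2 ^ 16)]
  have hNXpos : (0 : ℝ) < NX := by exact_mod_cast hNX1
  set z : ℕ := ⌊Real.sqrt (NX / T')⌋₊ with hz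
  have hsqrt0 : 0 ≤ Real.sqrt (NX / T') := Real.sqrt_nonneg _
  have hzle : (z : ℝ) ≤ Real.sqrt (NX / T') := Nat.floor_le hsqrt0
  have hzgt : Real.sqrt (NX / T') < z + 1 := Nat.lt_floor_add_one _
  have hzsq : (z : ℝ) ^ 2 * T' ≤ NX := by
    have h1 : (z : ℝ) ^ 2 ≤ NX / T' := by
      calc (z : ℝ) ^ 2 ≤ (Real.sqrt (NX / T')) ^ 2 := pow_le_pow_left₀ (Nat.cast_nonneg z) hzle 2
        _ = NX / T' := Real.sq_sqrt (by positivity)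
    rwa [le_div_iff₀ (by positivity)] at h1
  have hzx : (z : ℝ) ^ 2 * T' ≤ ⌊x ^ expoB⌋₊ + 1 := by rw [← ha, ← hNX]; linarith
  have hzhalf : (z : ℝ) ≤ x ^ (expoB / 2) := by
    rw [← ha]
    have h1 : Real.sqrt (NX / T') ≤ Real.sqrt (x ^ a) := by
      refine Real.sqrt_le_sqrt ?_
      calc (NX : ℝ) / T' ≤ NX := div_le_self hNXpos.le hT'1
        _ ≤ x ^ a := hNXle
    have h2 : Real.sqrt (x ^ a) = x ^ (a / 2) := by
      rw [Real.sqrt_eq_rpow, ← Real.rpow_mul hxpos.le]; ring_nf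
    linarith [h1.trans_eq h2]
  -- `z ≥ P^5/2 − 1 ≥ P²`, hence `z > ⌊P⌋` and `log(z/⌊P⌋) ≥ log P`
  have hT'le : T' ≤ 2 * P ^ (6 : ℕ) := by
    rw [hT']; have : (1 : ℝ) ≤ P ^ (6 : ℕ) := one_le_pow₀ (by linarith); linarith
  have hzlow : P ^ (5 : ℕ) / 2 - 1 ≤ z := by
    have h1 : P ^ (10 : ℕ) / 4 ≤ NX / T' := by
      rw [div_le_div_iff₀ (by norm_num) (by positivity)]
      have hp16 : P ^ (16 : ℕ) = P ^ (10 : ℕ) * P ^ (6 : ℕ) := by rw [← pow_add]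
      have h10 : 0 ≤ P ^ (10 : ℕ) := pow_nonneg hPpos.le 10
      have := mul_le_mul_of_nonneg_left hT'le h10
      nlinarith only [hNXhalf, this, hp16]
    have h2 : P ^ (5 : ℕ) / 2 ≤ Real.sqrt (NX / T') := by
      rw [Real.le_sqrt (by positivity) (div_nonneg hNXpos.le hT'0)]
      calc (P ^ (5 : ℕ) / 2) ^ 2 = P ^ (10 : ℕ) / 4 := by ring
        _ ≤ _ := h1
    linarith
  have hP5 : P ^ (2 : ℕ) + P + 1 ≤ P ^ (5 : ℕ) / 2 - 1 := by
    have hP2 : (4 : ℝ) ≤ P ^ (2 : ℕ) := by nlinarith only [hP]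
    have hP3 : P ^ (5 : ℕ) = P ^ (2 : ℕ) * P ^ (2 : ℕ) * P := by ring
    have hP4 : (16 : ℝ) * P ≤ P ^ (2 : ℕ) * P ^ (2 : ℕ) * P := by nlinarith only [hP2, hPpos]
    nlinarith only [hP3, hP4, hP, hP2]
  have hzP2 : P ^ (2 : ℕ) + P + 1 ≤ z := hP5.trans hzlow
  have hPfloor : (⌊P⌋₊ : ℝ) ≤ P := Nat.floor_le hPpos.le
  have hQ₁1 : 1 ≤ ⌊P⌋₊ := Nat.le_floor (by simp only [Nat.cast_one]; linarith)
  have hQ₁z : ⌊P⌋₊ < z := by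
    have : (⌊P⌋₊ : ℝ) < z := by nlinarith only [hzP2, hPfloor, hPpos]
    exact_mod_cast this
  have hlogz : Lp ≤ Real.log ((z : ℝ) / ⌊P⌋₊) := by
    have hQpos : (0 : ℝ) < ⌊P⌋₊ := by exact_mod_cast hQ₁1
    rw [hLp]
    refine Real.log_le_log hPpos ?_
    rw [le_div_iff₀ hQpos]
    calc P * ⌊P⌋₊ ≤ P * P := mul_le_mul_of_nonneg_left hPfloor hPpos.le
      _ ≤ z := by nlinarith only [hzP2, hPpos]
  /- ── the sieve side for every `t ∈ (NX, x]` ── -/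
  set Bt : ℝ := C_H / Lp * (2 * Lx ^ 2) with hBt
  have hsieve : ∀ t ∈ Set.Ioc (NX : ℝ) x,
      ∑ q ∈ Icc 1 ⌊P⌋₊, ∑ χ : DirichletCharacter ℂ q with χ.IsPrimitive,
        ∫ v in (-T')..T', ‖summatory (coefSifted χ v x z) t‖ ^ 2 ≤ Bt := by
    intro t ht
    refine (sieveSide hQ₁1 hQ₁z hT'1 hzx t).trans ?_
    have h1 : C_H / Real.log ((z : ℝ) / ⌊P⌋₊) ≤ C_H / Lp :=
      div_le_div_of_nonneg_left hC_Hpos.le hLppos hlogz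
    have h2 : ∑ n ∈ (siftedSet x z).filter (fun n => n ≤ ⌊t⌋₊), Λ n ^ 2 / n ≤ 2 * Lx ^ 2 := by
      have hsub : (siftedSet x z).filter (fun n => n ≤ ⌊t⌋₊) ⊆ Icc 1 ⌊x⌋₊ := by
        intro n hn
        rw [mem_filter] at hn
        obtain ⟨h1, h2, -⟩ := siftedSet_prop hn.1
        rw [mem_Icc]; omega
      refine (sum_le_sum_of_subset_of_nonneg hsub fun n _ _ => by positivity).trans ?_
      refine (sum_vonMangoldt_sq_div_le ⌊x⌋₊).trans ?_
      have hfl : Real.log ⌊x⌋₊ ≤ Lx := by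
        rw [← hlogx]
        rcases Nat.eq_zero_or_pos ⌊x⌋₊ with h0 | hpos
        · rw [h0, Nat.cast_zero, Real.log_zero, hlogx]; linarith
        · exact Real.log_le_log (by exact_mod_cast hpos) (Nat.floor_le hxpos.le)
      have hfl0 : 0 ≤ Real.log ⌊x⌋₊ := Real.log_natCast_nonneg _
      have hl4 : Real.log 4 ≤ 1.4 := by
        have h : Real.log 4 = 2 * Real.log 2 := by
          rw [show (4:ℝ) = 2 ^ 2 by norm_num, Real.log_pow]; norm_num
        rw [h]; have := Real.log_two_lt_d9; linarith
      have h5 : Real.log ⌊x⌋₊ * (Real.log ⌊x⌋₊ + Real.log 4 + 2) ≤ Lx * (Lx + 4) :=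
        mul_le_mul hfl (by linarith) (by linarith [Real.log_nonneg (by norm_num : (1:ℝ) ≤ 4)]) hLxnn
      nlinarith only [h5, hLx4]
    exact mul_le_mul h1 h2 (sum_nonneg fun n _ => by positivity) (by positivity)
  /- ── the zero side for every primitive `χ` mod `q' + 1` ── -/
  set L₀ : ℝ := Real.exp (-10) * x ^ (-(r / 10)) / r ^ 3 with hL₀
  have hL₀pos : 0 < L₀ := by rw [hL₀]; positivity
  have hLL' : ∀ q' ∈ Finset.Ico 1 ⌊P⌋₊, Real.log ((q' + 1 : ℕ) : ℝ) + Real.log (T' + 4) ≤ L' := by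
    intro q' hq'
    rw [Finset.mem_Ico] at hq'
    have hq : ((q' + 1 : ℕ) : ℝ) ≤ P := by
      have : ((q' + 1 : ℕ) : ℝ) ≤ ⌊P⌋₊ := by exact_mod_cast hq'.2
      exact this.trans hPfloor
    have h1 : Real.log ((q' + 1 : ℕ) : ℝ) ≤ Lp := Real.log_le_log (by positivity) hq
    have h2 : Real.log (T' + 4) ≤ 7 * Lp := by
      have hP6 : (64 : ℝ) ≤ P ^ (6 : ℕ) := by
        calc (64 : ℝ) = 2 ^ (6 : ℕ) := by norm_num
          _ ≤ P ^ (6 : ℕ) := pow_le_pow_left₀ (by norm_num) hP 6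
      have h3 : T' + 4 ≤ 2 * P ^ (6 : ℕ) := by rw [hT']; linarith
      calc Real.log (T' + 4) ≤ Real.log (2 * P ^ (6 : ℕ)) := Real.log_le_log (by linarith) h3
        _ = Real.log 2 + 6 * Lp := by
            rw [Real.log_mul (by norm_num) (by positivity), Real.log_pow]; norm_num; rfl
        _ ≤ 7 * Lp := by linarith
    linarith
  have hzero : ∀ q' ∈ Finset.Ico 1 ⌊P⌋₊, ∀ χ : DirichletCharacter ℂ (q' + 1), χ.IsPrimitive →
      r * L₀ * ∑ ρ ∈ Z (q' + 1) χ with α ≤ ρ.re, (zeroOrder χ ρ : ℝ) ≤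
        C_z * (r * L') * ∫ v in (-T')..T', meanValue χ x z v := by
    intro q' hq' χ hχ
    have hq2 : 2 ≤ q' + 1 := by rw [Finset.mem_Ico] at hq'; omega
    have hχ1 : χ ≠ 1 := ne_one_of_isPrimitive hq2 hχ
    refine hZS (q' + 1) χ hχ1 T' r L' x z _ (hLL' q' hq') hrpos hrr₀ hu hx1 hLxA₀ hzhalf hT'0 ?_
    intro ρ hρ
    rw [mem_filter] at hρ
    obtain ⟨h0, -, hre1, him⟩ := hZ q' χ ρ hρ.1
    refine ⟨h0, by rw [hr]; linarith [hρ.2], hre1, ?_⟩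
    rw [hT', hr]; linarith
  /- ── summing over `q'` and `χ` ── -/
  set S : ℝ := ∑ q' ∈ Finset.Ico 1 ⌊P⌋₊, ∑ χ : DirichletCharacter ℂ (q' + 1) with χ.IsPrimitive,
      ∑ ρ ∈ Z (q' + 1) χ with α ≤ ρ.re, (zeroOrder χ ρ : ℝ) with hS
  set f : ℕ → ℝ := fun q => ∑ χ : DirichletCharacter ℂ q with χ.IsPrimitive,
      ∫ v in (-T')..T', meanValue χ x z v with hf
  have hf0 : ∀ q, 0 ≤ f q := fun q => sum_nonneg fun χ _ =>
      intervalIntegral.integral_nonneg (by linarith) fun v _ => meanValue_nonneg χ x z v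
  have hstep1 : r * L₀ * S ≤ C_z * (r * L') * ∑ q' ∈ Finset.Ico 1 ⌊P⌋₊, f (q' + 1) := by
    rw [hS, mul_sum, mul_sum]
    refine sum_le_sum fun q' hq' => ?_
    rw [mul_sum, hf]; dsimp only; rw [mul_sum]
    refine sum_le_sum fun χ hχ => ?_
    rw [mem_filter] at hχ
    exact hzero q' hq' χ hχ.2
  have hstep2 : ∑ q' ∈ Finset.Ico 1 ⌊P⌋₊, f (q' + 1) ≤ ∑ q ∈ Icc 1 ⌊P⌋₊, f q := by
    rw [Finset.sum_Ico_add' f 1 ⌊P⌋₊ 1]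
    refine sum_le_sum_of_subset_of_nonneg ?_ fun q _ _ => hf0 q
    intro q hq; rw [Finset.mem_Ico] at hq; rw [mem_Icc]; omega
  -- Fubini and the sieve bound
  have hNXx : (NX : ℝ) ≤ x := by
    refine hNXle.trans ?_
    rw [ha]
    exact Real.rpow_le_self_of_one_le hx1 (by linarith [expoB_le_half])
  have hstep3 : ∑ q ∈ Icc 1 ⌊P⌋₊, f q ≤ Bt * Lx := by
    -- rewrite every `f q` as a `t`-integral
    set g : (q : ℕ) → DirichletCharacter ℂ q → ℝ → ℝ := fun q χ t =>
      (∫ v in (-T')..T', ‖summatory (coefSifted χ v x z) t‖ ^ 2) / t with hg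
    have hgi : ∀ (q : ℕ) (χ : DirichletCharacter ℂ q), IntegrableOn (g q χ) (Set.Ioc (NX : ℝ) x) :=
      fun q χ => integrableOn_inner χ x z hNX1 hT'0
    have heq : ∀ q, f q = ∫ t in Set.Ioc (NX : ℝ) x,
        ∑ χ : DirichletCharacter ℂ q with χ.IsPrimitive, g q χ t := by
      intro q
      rw [hf]; dsimp only
      rw [integral_finsetSum _ fun χ _ => hgi q χ]
      refine sum_congr rfl fun χ _ => ?_
      exact integral_meanValue_eq χ x z hNX1 hT'0
    rw [sum_congr rfl fun q _ => heq q,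
      ← integral_finsetSum _ fun q _ => integrable_finsetSum _ fun χ _ => hgi q χ]
    -- pointwise bound by `Bt / t`
    have hBtint : IntegrableOn (fun t : ℝ => Bt * t⁻¹) (Set.Ioc (NX : ℝ) x) := by
      refine ((continuousOn_const.mul (continuousOn_inv₀.mono ?_)).integrableOn_compact isCompact_Icc).mono_set
        Set.Ioc_subset_Icc_self
      intro t ht; exact (hNXpos.trans_le ht.1).ne'
    calc ∫ t in Set.Ioc (NX : ℝ) x, ∑ q ∈ Icc 1 ⌊P⌋₊,
          ∑ χ : DirichletCharacter ℂ q with χ.IsPrimitive, g q χ t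
        ≤ ∫ t in Set.Ioc (NX : ℝ) x, Bt * t⁻¹ := by
          refine setIntegral_mono_on (integrable_finsetSum _ fun q _ => integrable_finsetSum _ fun χ _ => hgi q χ)
            hBtint measurableSet_Ioc fun t ht => ?_
          have ht0 : 0 < t := hNXpos.trans ht.1
          have h1 := hsieve t ht
          have h2 : ∑ q ∈ Icc 1 ⌊P⌋₊, ∑ χ : DirichletCharacter ℂ q with χ.IsPrimitive, g q χ t =
              (∑ q ∈ Icc 1 ⌊P⌋₊, ∑ χ : DirichletCharacter ℂ q with χ.IsPrimitive,
                ∫ v in (-T')..T', ‖summatory (coefSifted χ v x z) t‖ ^ 2) / t := by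
            rw [sum_div]; refine sum_congr rfl fun q _ => ?_; rw [sum_div]
          rw [h2, div_eq_mul_inv]
          exact mul_le_mul_of_nonneg_right h1 (inv_nonneg.2 ht0.le)
      _ = Bt * Real.log (x / NX) := by
          rw [integral_const_mul, ← intervalIntegral.integral_of_le hNXx, integral_inv_of_pos hNXpos hxpos]
      _ ≤ Bt * Lx := by
          refine mul_le_mul_of_nonneg_left ?_ (by positivity)
          rw [Real.log_div hxpos.ne' hNXpos.ne', hlogx]
          linarith [Real.log_nonneg (show (1:ℝ) ≤ NX by exact_mod_cast hNX1)]
  have hmain := hstep1.trans (mul_le_mul_of_nonneg_left (hstep2.trans hstep3) (by positivity))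
  /- ── the final arithmetic ── -/
  have hK : C_z * (r * L') * (Bt * Lx) = r * (K₁ * Lp ^ 3) := by
    rw [hBt, hLx, hL', hK₁]; field_simp
  rw [hK] at hmain
  -- divide by `r L₀`
  have hdiv : S ≤ K₁ * Lp ^ 3 / L₀ := by
    rw [le_div_iff₀ hL₀pos]
    have h1 : r * (L₀ * S) ≤ r * (K₁ * Lp ^ 3) := by rw [← mul_assoc]; exact hmain
    have h2 := le_of_mul_le_mul_left h1 hrpos
    linarith [mul_comm L₀ S]
  refine hdiv.trans ?_
  -- `K₁ Lp³ / L₀ = K₁ e^{10} (r Lp)³ x^{r/10} ≤ K₁ e^{10} P^{A(1−α)}`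
  have hxr : x ^ (r / 10) = Real.exp (A₁ * B / 10 * r * Lp) := by
    rw [hx, ← Real.exp_mul, hLx, hL']; ring_nf
  have hL₀eq : K₁ * Lp ^ 3 / L₀ = K₁ * Real.exp 10 * ((r * Lp) ^ 3 * x ^ (r / 10)) := by
    rw [hL₀, Real.rpow_neg hxpos.le, Real.exp_neg]
    have hx10 : 0 < x ^ (r / 10) := by positivity
    field_simp
  rw [hL₀eq]
  have hcube : (r * Lp) ^ 3 ≤ Real.exp (3 * (r * Lp)) := cube_le_exp (by positivity)
  have hPpow : P ^ ((A₁ * B / 10 + 3) * 2 * (1 - α)) =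
      Real.exp (3 * (r * Lp)) * Real.exp (A₁ * B / 10 * r * Lp) := by
    rw [Real.rpow_def_of_pos hPpos, ← Real.exp_add, ← hLp, hr]; ring_nf
  rw [hPpow, hxr]
  refine mul_le_mul_of_nonneg_left ?_ (by positivity)
  exact mul_le_mul_of_nonneg_right hcube (Real.exp_pos _).le

/-! ### The range `1 − α < c₁/log P`: at most one zero (Landau–Page) -/

/-- A zero `β` of `L(s, χ)` with `L'(β, χ) ≠ 0` is simple: `m(β) ≤ 1`. [folklore] -/
theorem zeroOrder_le_one_of_deriv_ne_zero {q : ℕ} [NeZero q] {χ : DirichletCharacter ℂ q} (hχ : χ ≠ 1)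
    {ρ : ℂ} (h0 : χ.LFunction ρ = 0) (hd : deriv χ.LFunction ρ ≠ 0) : zeroOrder χ ρ ≤ 1 := by
  have han : AnalyticAt ℂ χ.LFunction ρ := (DirichletCharacter.differentiable_LFunction hχ).analyticAt ρ
  have hne := analyticOrderAt_LFunction_ne_top χ hχ ρ
  have key : analyticOrderAt (deriv χ.LFunction) ρ + 1 = analyticOrderAt χ.LFunction ρ := by
    rw [han.analyticOrderAt_deriv_add_one]
    congr 1
    funext s; rw [h0, sub_zero]
  have hd0 : analyticOrderAt (deriv χ.LFunction) ρ = 0 := (han.deriv.analyticOrderAt_eq_zero).2 hd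
  rw [hd0, zero_add] at key
  have : (zeroOrder χ ρ : ℕ∞) = 1 := by
    rw [zeroOrder, Nat.cast_analyticOrderNatAt hne, ← key]
  have : zeroOrder χ ρ = 1 := by exact_mod_cast this
  omega

open scoped Classical in
/-- **Théorème 14 for `α` within `c₁/log P` of `1`** (Bombieri p. 48: "Par le Lemme de
Landau–Page, on peut supposer `α ≤ 1 − c₁/log T` car sinon on a `N(α, T; χ) = 0`" — for the sum
over all `χ` the exceptional real zero may survive, and it is counted once): there is an absolute
`c₁ > 0` such that for `P ≥ 2`, `α ≤ 1`, `1 − α < c₁/log P` and any finite sets of zeros of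
`L(s, χ)` in `0 < β < 1`, `|γ| ≤ P^6`, the multiplicity-weighted count of those with `β ≥ α` over
the primitive `χ` of modulus `2 ≤ q ≤ P` is at most `1` (zero-free region, Landau's and Page's
theorems, simplicity of the exceptional zero — all from the tree). [cite: Bombieri1987GrandCrible, §6 Théorème 14 (proof)] -/
theorem smallRange :
    ∃ c₁ : ℝ, 0 < c₁ ∧
      ∀ P : ℝ, 2 ≤ P → ∀ Z : (q : ℕ) → DirichletCharacter ℂ q → Finset ℂ,
        (∀ (q' : ℕ) (χ : DirichletCharacter ℂ (q' + 1)), ∀ ρ ∈ Z (q' + 1) χ,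
            χ.LFunction ρ = 0 ∧ 0 < ρ.re ∧ ρ.re < 1 ∧ |ρ.im| ≤ P ^ 6) →
        ∀ α : ℝ, 1 - α < c₁ / Real.log P →
          ∑ q' ∈ Finset.Ico 1 ⌊P⌋₊, ∑ χ : DirichletCharacter ℂ (q' + 1) with χ.IsPrimitive,
            ∑ ρ ∈ Z (q' + 1) χ with α ≤ ρ.re, (zeroOrder χ ρ : ℝ) ≤ 1 := by
  obtain ⟨c_Z, hc_Z, hZF⟩ := DirichletZFR.exists_zeroFree
  obtain ⟨c_L, hc_L, hLan⟩ := DirichletZFR.exists_landau_prodChar_min_le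
  obtain ⟨c_M, hc_M, hLanS⟩ := DirichletZFR.exists_landau_sameLevel_min_le
  obtain ⟨c_P, hc_P, hPage⟩ := DirichletZFR.exists_min_realZeros_le
  obtain ⟨c_S, hc_S, hSimple⟩ := DirichletZFR.exists_deriv_ne_zero_of_realZero
  set c₁ : ℝ := min (min (c_Z / 8) (c_L / 4)) (min (c_M / 3) (min (c_P / 3) (c_S / 3))) with hc₁
  have h1 : c₁ ≤ c_Z / 8 := (min_le_left _ _).trans (min_le_left _ _)
  have h2 : c₁ ≤ c_L / 4 := (min_le_left _ _).trans (min_le_right _ _)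
  have h3 : c₁ ≤ c_M / 3 := (min_le_right _ _).trans (min_le_left _ _)
  have h4 : c₁ ≤ c_P / 3 := (min_le_right _ _).trans ((min_le_right _ _).trans (min_le_left _ _))
  have h5 : c₁ ≤ c_S / 3 := (min_le_right _ _).trans ((min_le_right _ _).trans (min_le_right _ _))
  have hc₁pos : 0 < c₁ := by rw [hc₁]; positivity
  refine ⟨c₁, hc₁pos, fun P hP Z hZ α hα => ?_⟩
  classical
  have hPpos : 0 < P := by linarith
  set Lp : ℝ := Real.log P with hLp
  have hLp2 : Real.log 2 ≤ Lp := Real.log_le_log (by norm_num) hP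
  have hlog2 : (0.69 : ℝ) ≤ Real.log 2 := by have := Real.log_two_gt_d9; linarith
  have hLppos : 0 < Lp := by linarith
  have hlog4 : Real.log 4 ≤ 2 * Lp := by
    rw [show (4:ℝ) = 2 ^ 2 by norm_num, Real.log_pow]; push_cast; linarith
  have hPfloor : (⌊P⌋₊ : ℝ) ≤ P := Nat.floor_le hPpos.le
  have hα' : 1 - c₁ / Lp < α := by linarith
  -- moduli and heights
  have hlogq : ∀ q' ∈ Finset.Ico 1 ⌊P⌋₊, Real.log ((q' + 1 : ℕ) : ℝ) ≤ Lp := by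
    intro q' hq'
    rw [Finset.mem_Ico] at hq'
    have hq : ((q' + 1 : ℕ) : ℝ) ≤ P := by
      have : ((q' + 1 : ℕ) : ℝ) ≤ ⌊P⌋₊ := by exact_mod_cast hq'.2
      exact this.trans hPfloor
    exact Real.log_le_log (by positivity) hq
  -- every counted zero is a real zero of a quadratic character
  have hreal : ∀ q' ∈ Finset.Ico 1 ⌊P⌋₊, ∀ χ : DirichletCharacter ℂ (q' + 1), χ.IsPrimitive →
      ∀ ρ ∈ Z (q' + 1) χ, α ≤ ρ.re → χ ^ 2 = 1 ∧ ρ = ((ρ.re : ℝ) : ℂ) ∧ χ.LFunction (ρ.re : ℂ) = 0 := by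
    intro q' hq' χ hχ ρ hρ hαρ
    have hq2 : 2 ≤ q' + 1 := by rw [Finset.mem_Ico] at hq'; omega
    have hχ1 : χ ≠ 1 := ne_one_of_isPrimitive hq2 hχ
    obtain ⟨h0, -, hre1, him⟩ := hZ q' χ ρ hρ
    have hℒ : Real.log ((q' + 1 : ℕ) : ℝ) + Real.log (|ρ.im| + 4) ≤ 8 * Lp := by
      have hP6 : (64 : ℝ) ≤ P ^ (6 : ℕ) := by
        calc (64 : ℝ) = 2 ^ (6 : ℕ) := by norm_num
          _ ≤ P ^ (6 : ℕ) := pow_le_pow_left₀ (by norm_num) hP 6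
      have h3 : |ρ.im| + 4 ≤ 2 * P ^ (6 : ℕ) := by linarith
      have : Real.log (|ρ.im| + 4) ≤ Real.log 2 + 6 * Lp := by
        calc Real.log (|ρ.im| + 4) ≤ Real.log (2 * P ^ (6 : ℕ)) :=
              Real.log_le_log (by positivity) h3
          _ = Real.log 2 + 6 * Lp := by
              rw [Real.log_mul (by norm_num) (by positivity), Real.log_pow]; norm_num; rfl
      linarith [hlogq q' hq']
    have hzf := hZF (q' + 1) χ hχ1 ρ h0 (by
      have hℒpos : 0 < Real.log ((q' + 1 : ℕ) : ℝ) + Real.log (|ρ.im| + 4) := by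
        have := Real.log_nonneg (show (1:ℝ) ≤ ((q' + 1 : ℕ) : ℝ) by
          exact_mod_cast (show 1 ≤ q' + 1 by omega))
        have h4 : Real.log 4 ≤ Real.log (|ρ.im| + 4) :=
          Real.log_le_log (by norm_num) (by linarith [abs_nonneg ρ.im])
        have : 0 < Real.log 4 := Real.log_pos (by norm_num)
        linarith
      have : c₁ / Lp ≤ c_Z / (Real.log ((q' + 1 : ℕ) : ℝ) + Real.log (|ρ.im| + 4)) := by
        rw [div_le_div_iff₀ hLppos hℒpos]
        have e1 := mul_le_mul_of_nonneg_right h1 hℒpos.le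
        have e2 := mul_le_mul_of_nonneg_left hℒ (show (0:ℝ) ≤ c_Z / 8 by positivity)
        linarith
      linarith)
    have hρeq : ρ = ((ρ.re : ℝ) : ℂ) := by
      apply Complex.ext <;> simp [hzf.2]
    exact ⟨hzf.1, hρeq, by rw [← hρeq]; exact h0⟩
  -- the Landau threshold over moduli `≤ P`
  have hthr : ∀ {c k : ℝ}, 0 < c → 0 < k → c₁ ≤ c / k → ∀ {M : ℝ}, 0 < M → M ≤ k * Lp →
      1 - c / M < α := by
    intro c k hc hk hcc M hM hMk
    have : c₁ / Lp ≤ c / M := by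
      rw [div_le_div_iff₀ hLppos hM]
      have e1 := mul_le_mul_of_nonneg_right hcc hM.le
      have e2 := mul_le_mul_of_nonneg_left hMk (show (0:ℝ) ≤ c / k by positivity)
      have e3 : c / k * (k * Lp) = c * Lp := by field_simp
      linarith
    linarith
  by_cases hex : ∃ q₀ ∈ Finset.Ico 1 ⌊P⌋₊, ∃ χ₀ : DirichletCharacter ℂ (q₀ + 1), χ₀.IsPrimitive ∧
      ∃ ρ₀ ∈ Z (q₀ + 1) χ₀, α ≤ ρ₀.re
  swap
  · -- no counted zero at all
    push Not at hex
    refine le_trans (le_of_eq ?_) zero_le_one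
    refine sum_eq_zero fun q' hq' => sum_eq_zero fun χ hχ => sum_eq_zero fun ρ hρ => ?_
    rw [mem_filter] at hχ hρ
    exact absurd hρ.2 (not_le.2 (hex q' hq' χ hχ.2 ρ hρ.1))
  obtain ⟨q₀, hq₀, χ₀, hχ₀, ρ₀, hρ₀, hα₀⟩ := hex
  obtain ⟨hχ₀sq, hρ₀eq, hρ₀zero⟩ := hreal q₀ hq₀ χ₀ hχ₀ ρ₀ hρ₀ hα₀
  have hq₀2 : 2 ≤ q₀ + 1 := by rw [Finset.mem_Ico] at hq₀; omega
  have hχ₀1 : χ₀ ≠ 1 := ne_one_of_isPrimitive hq₀2 hχ₀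
  -- (a) every other modulus contributes nothing (Landau, different moduli)
  rw [sum_eq_single_of_mem q₀ hq₀ ?_]
  swap
  · intro q' hq' hne
    refine sum_eq_zero fun χ hχ => sum_eq_zero fun ρ hρ => ?_
    rw [mem_filter] at hχ hρ
    exfalso
    obtain ⟨hχsq, hρeq, hρzero⟩ := hreal q' hq' χ hχ.2 ρ hρ.1 hρ.2
    have hq2 : 2 ≤ q' + 1 := by rw [Finset.mem_Ico] at hq'; omega
    have hχ1 : χ ≠ 1 := ne_one_of_isPrimitive hq2 hχ.2
    have hne' : q' + 1 ≠ q₀ + 1 := by omega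
    have hψ := DirichletZFR.prodChar_ne_one_of_isPrimitive χ hχ.2 χ₀ hχ₀ hχ₀sq hne'
    have hL := hLan (q' + 1) (q₀ + 1) χ χ₀ hχ1 hχ₀1 hχsq hχ₀sq hψ ρ.re ρ₀.re hρzero hρ₀zero
    have hM : Real.log (((q' + 1 : ℕ) : ℝ) * ((q₀ + 1 : ℕ) : ℝ)) + Real.log 4 ≤ 4 * Lp := by
      rw [Real.log_mul (by positivity) (by positivity)]
      linarith [hlogq q' hq', hlogq q₀ hq₀]
    have hMpos : 0 < Real.log (((q' + 1 : ℕ) : ℝ) * ((q₀ + 1 : ℕ) : ℝ)) + Real.log 4 := by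
      have : 0 ≤ Real.log (((q' + 1 : ℕ) : ℝ) * ((q₀ + 1 : ℕ) : ℝ)) :=
        Real.log_nonneg (by
          have : (1 : ℝ) ≤ ((q' + 1 : ℕ) : ℝ) := by exact_mod_cast (by omega : 1 ≤ q' + 1)
          have : (1 : ℝ) ≤ ((q₀ + 1 : ℕ) : ℝ) := by exact_mod_cast (by omega : 1 ≤ q₀ + 1)
          nlinarith)
      have : 0 < Real.log 4 := Real.log_pos (by norm_num)
      linarith
    have := hthr hc_L (by norm_num) h2 hMpos hM
    have hmin : α ≤ min ρ.re ρ₀.re := le_min hρ.2 hα₀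
    linarith
  -- (b) at the modulus `q₀ + 1`, every other character contributes nothing (Landau, one modulus)
  have hχ₀mem : χ₀ ∈ (Finset.univ.filter fun χ : DirichletCharacter ℂ (q₀ + 1) => χ.IsPrimitive) := by
    rw [mem_filter]; exact ⟨mem_univ _, hχ₀⟩
  rw [sum_eq_single_of_mem χ₀ hχ₀mem ?_]
  swap
  · intro χ hχ hne
    rw [mem_filter] at hχ
    refine sum_eq_zero fun ρ hρ => ?_
    rw [mem_filter] at hρ
    exfalso
    obtain ⟨hχsq, hρeq, hρzero⟩ := hreal q₀ hq₀ χ hχ.2 ρ hρ.1 hρ.2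
    have hχ1 : χ ≠ 1 := ne_one_of_isPrimitive hq₀2 hχ.2
    have hL := hLanS (q₀ + 1) χ χ₀ hχ1 hχ₀1 hχsq hχ₀sq hne ρ.re ρ₀.re hρzero hρ₀zero
    have hM : Real.log ((q₀ + 1 : ℕ) : ℝ) + Real.log 4 ≤ 3 * Lp := by linarith [hlogq q₀ hq₀]
    have hMpos : 0 < Real.log ((q₀ + 1 : ℕ) : ℝ) + Real.log 4 := by
      have : 0 ≤ Real.log ((q₀ + 1 : ℕ) : ℝ) := Real.log_natCast_nonneg _
      have : 0 < Real.log 4 := Real.log_pos (by norm_num)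
      linarith
    have := hthr hc_M (by norm_num) h3 hMpos hM
    have hmin : α ≤ min ρ.re ρ₀.re := le_min hρ.2 hα₀
    linarith
  -- (c) the remaining character: all counted zeros coincide with `ρ₀` (Page), which is simple
  have hM : Real.log ((q₀ + 1 : ℕ) : ℝ) + Real.log 4 ≤ 3 * Lp := by linarith [hlogq q₀ hq₀]
  have hMpos : 0 < Real.log ((q₀ + 1 : ℕ) : ℝ) + Real.log 4 := by
    have : 0 ≤ Real.log ((q₀ + 1 : ℕ) : ℝ) := Real.log_natCast_nonneg _
    have : 0 < Real.log 4 := Real.log_pos (by norm_num)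
    linarith
  have hsub : (Z (q₀ + 1) χ₀).filter (fun ρ => α ≤ ρ.re) ⊆ {ρ₀} := by
    intro ρ hρ
    rw [mem_filter] at hρ
    rw [Finset.mem_singleton]
    obtain ⟨-, hρeq, hρzero⟩ := hreal q₀ hq₀ χ₀ hχ₀ ρ hρ.1 hρ.2
    by_contra hne
    have hne' : ρ.re ≠ ρ₀.re := by
      intro h; exact hne (by rw [hρeq, hρ₀eq, h])
    have hPg := hPage (q₀ + 1) χ₀ hχ₀1 ρ.re ρ₀.re hρzero hρ₀zero hne'
    have := hthr hc_P (by norm_num) h4 hMpos hM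
    have hmin : α ≤ min ρ.re ρ₀.re := le_min hρ.2 hα₀
    linarith
  have hsimple : zeroOrder χ₀ ρ₀ ≤ 1 := by
    have hthr' := hthr hc_S (by norm_num) h5 hMpos hM
    have hd := hSimple (q₀ + 1) χ₀ hχ₀1 ρ₀.re hρ₀zero (by linarith)
    refine zeroOrder_le_one_of_deriv_ne_zero hχ₀1 (hZ q₀ χ₀ ρ₀ hρ₀).1 ?_
    rw [hρ₀eq]; exact hd
  calc ∑ ρ ∈ (Z (q₀ + 1) χ₀).filter (fun ρ => α ≤ ρ.re), (zeroOrder χ₀ ρ : ℝ)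
      ≤ ∑ ρ ∈ ({ρ₀} : Finset ℂ), (zeroOrder χ₀ ρ : ℝ) :=
        sum_le_sum_of_subset_of_nonneg hsub fun ρ _ _ => Nat.cast_nonneg _
    _ = zeroOrder χ₀ ρ₀ := by rw [sum_singleton]
    _ ≤ 1 := by exact_mod_cast hsimple

/-! ### The range `1 − α > δ₀`: the trivial count -/

/-- The number of Dirichlet characters mod `q` with complex values is `φ(q) ≤ q`. [folklore] -/
theorem card_dirichletCharacter_le (q : ℕ) [NeZero q] : Fintype.card (DirichletCharacter ℂ q) ≤ q := by
  rw [← Nat.card_eq_fintype_card, DirichletCharacter.card_eq_totient_of_hasEnoughRootsOfUnity ℂ q]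
  exact Nat.totient_le q

open scoped Classical in
/-- **The trivial bound** (Bombieri p. 51: "le Théorème 14 est trivial si `α ≤ 1 − ε` … si
l'exposant `c₂` est assez grand"): there is an absolute `C` with
`∑_{2 ≤ q ≤ P} ∑*_χ ∑_{ρ ∈ Z(q,χ)} m(ρ) ≤ C P^9` for any finite sets `Z(q, χ)` of zeros of `L(s, χ)`
in `0 < β < 1`, `|γ| ≤ P^6` (the window count `N(T+1, χ) − N(T, χ) ≪ log qT` of the tree summed over
`≪ P^6` windows, `φ(q) ≤ P` characters and `P` moduli). [cite: Bombieri1987GrandCrible, §6 Théorème 14 (proof)] -/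
theorem largeRange :
    ∃ C : ℝ, 0 < C ∧
      ∀ P : ℝ, 2 ≤ P → ∀ Z : (q : ℕ) → DirichletCharacter ℂ q → Finset ℂ,
        (∀ (q' : ℕ) (χ : DirichletCharacter ℂ (q' + 1)), ∀ ρ ∈ Z (q' + 1) χ,
            χ.LFunction ρ = 0 ∧ 0 < ρ.re ∧ ρ.re < 1 ∧ |ρ.im| ≤ P ^ 6) →
          ∑ q' ∈ Finset.Ico 1 ⌊P⌋₊, ∑ χ : DirichletCharacter ℂ (q' + 1) with χ.IsPrimitive,
            ∑ ρ ∈ Z (q' + 1) χ, (zeroOrder χ ρ : ℝ) ≤ C * P ^ (9 : ℕ) := by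
  obtain ⟨C_w, hC_w, hwin⟩ := ExplicitPsiChar.exists_sum_window_le
  refine ⟨32 * C_w, by positivity, fun P hP Z hZ => ?_⟩
  classical
  have hPpos : 0 < P := by linarith
  set Lp : ℝ := Real.log P with hLp
  have hLp2 : Real.log 2 ≤ Lp := Real.log_le_log (by norm_num) hP
  have hlog2 : (0.69 : ℝ) ≤ Real.log 2 := by have := Real.log_two_gt_d9; linarith
  have hLppos : 0 < Lp := by linarith
  have hLpP : Lp ≤ P := by rw [hLp]; exact (Real.log_le_sub_one_of_pos hPpos).trans (by linarith)
  have hPfloor : (⌊P⌋₊ : ℝ) ≤ P := Nat.floor_le hPpos.le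
  have hP6 : (64 : ℝ) ≤ P ^ (6 : ℕ) := by
    calc (64 : ℝ) = 2 ^ (6 : ℕ) := by norm_num
      _ ≤ P ^ (6 : ℕ) := pow_le_pow_left₀ (by norm_num) hP 6
  -- the windows
  set M : ℤ := ⌈P ^ (6 : ℕ)⌉ + 1 with hM
  have hMle : (M : ℝ) ≤ P ^ (6 : ℕ) + 2 := by
    rw [hM]; push_cast; linarith [(Int.ceil_lt_add_one (P ^ (6 : ℕ))).le]
  set J : Finset ℤ := Finset.Icc (-M) M with hJ
  have hcardJ : (J.card : ℝ) ≤ 4 * P ^ (6 : ℕ) := by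
    have h0 : 0 ≤ M := by
      rw [hM]; have := Int.ceil_nonneg (pow_nonneg hPpos.le 6); omega
    have : (J.card : ℤ) = 2 * M + 1 := by
      rw [hJ, Int.card_Icc]; omega
    have hc : (J.card : ℝ) = 2 * M + 1 := by exact_mod_cast this
    rw [hc]; linarith
  -- per character
  have hper : ∀ q' ∈ Finset.Ico 1 ⌊P⌋₊, ∀ χ : DirichletCharacter ℂ (q' + 1), χ.IsPrimitive →
      ∑ ρ ∈ Z (q' + 1) χ, (zeroOrder χ ρ : ℝ) ≤ 32 * C_w * P ^ (6 : ℕ) * Lp := by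
    intro q' hq' χ hχ
    rw [Finset.mem_Ico] at hq'
    have hq1 : 1 < q' + 1 := by omega
    have hlogq : Real.log ((q' + 1 : ℕ) : ℝ) ≤ Lp := by
      have hq : ((q' + 1 : ℕ) : ℝ) ≤ P := by
        have : ((q' + 1 : ℕ) : ℝ) ≤ ⌊P⌋₊ := by exact_mod_cast hq'.2
        exact this.trans hPfloor
      exact Real.log_le_log (by positivity) hq
    -- fibres over the nearest integer to `γ`
    set g : ℂ → ℤ := fun ρ => ⌊ρ.im + 1 / 2⌋ with hg
    have hmaps : ∀ ρ ∈ Z (q' + 1) χ, g ρ ∈ J := by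
      intro ρ hρ
      obtain ⟨-, -, -, him⟩ := hZ q' χ ρ hρ
      rw [hJ, Finset.mem_Icc, hg]; dsimp only
      have h1 := abs_le.1 him
      have hc1 : (⌈P ^ (6 : ℕ)⌉ : ℝ) ≥ P ^ (6 : ℕ) := Int.le_ceil _
      constructor
      · rw [hM]
        have : (-(⌈P ^ (6 : ℕ)⌉ + 1) : ℤ) ≤ ⌊ρ.im + 1 / 2⌋ := by
          rw [Int.le_floor]
          have e : (((-(⌈P ^ (6 : ℕ)⌉ + 1) : ℤ) : ℝ)) = -((⌈P ^ (6 : ℕ)⌉ : ℝ) + 1) := by push_cast; ring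
          rw [e]; linarith
        exact this
      · rw [hM]
        have : ⌊ρ.im + 1 / 2⌋ ≤ ⌈P ^ (6 : ℕ)⌉ + 1 := by
          have : ⌊ρ.im + 1 / 2⌋ ≤ ⌈P ^ (6 : ℕ)⌉ + 1 ↔ ((⌊ρ.im + 1 / 2⌋ : ℤ) : ℝ) ≤ ((⌈P ^ (6 : ℕ)⌉ + 1 : ℤ) : ℝ) := by
            exact_mod_cast Iff.rfl
          rw [this]; push_cast
          linarith [Int.floor_le (ρ.im + 1 / 2)]
        exact this
    rw [← Finset.sum_fiberwise_of_maps_to hmaps]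
    have hfib : ∀ j ∈ J, ∑ ρ ∈ (Z (q' + 1) χ).filter (fun ρ => g ρ = j), (zeroOrder χ ρ : ℝ) ≤
        C_w * (8 * Lp) := by
      intro j hj
      have hj' : |(j : ℝ)| ≤ P ^ (6 : ℕ) + 2 := by
        rw [hJ, Finset.mem_Icc] at hj
        have h1 : (-(M : ℝ)) ≤ j := by exact_mod_cast hj.1
        have h2 : (j : ℝ) ≤ M := by exact_mod_cast hj.2
        rw [abs_le]; constructor <;> linarith
      have h := hwin (q' + 1) χ hχ hq1 (j : ℝ) ((Z (q' + 1) χ).filter (fun ρ => g ρ = j)) (by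
        intro ρ hρ
        rw [mem_filter] at hρ
        obtain ⟨h0, hre0, hre1, -⟩ := hZ q' χ ρ hρ.1
        refine ⟨h0, hre0, hre1, ?_⟩
        have hgj : ⌊ρ.im + 1 / 2⌋ = j := hρ.2
        have h1 := Int.floor_le (ρ.im + 1 / 2)
        have h2 := Int.lt_floor_add_one (ρ.im + 1 / 2)
        rw [hgj] at h1 h2
        rw [abs_le]; constructor <;> linarith)
      refine h.trans (mul_le_mul_of_nonneg_left ?_ hC_w.le)
      have : Real.log (|(j : ℝ)| + 4) ≤ 7 * Lp := by
        have h3 : |(j : ℝ)| + 4 ≤ 2 * P ^ (6 : ℕ) := by linarith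
        calc Real.log (|(j : ℝ)| + 4) ≤ Real.log (2 * P ^ (6 : ℕ)) :=
              Real.log_le_log (by positivity) h3
          _ = Real.log 2 + 6 * Lp := by
              rw [Real.log_mul (by norm_num) (by positivity), Real.log_pow]; norm_num; rfl
          _ ≤ 7 * Lp := by linarith
      linarith
    calc ∑ j ∈ J, ∑ ρ ∈ (Z (q' + 1) χ).filter (fun ρ => g ρ = j), (zeroOrder χ ρ : ℝ)
        ≤ ∑ j ∈ J, C_w * (8 * Lp) := sum_le_sum hfib
      _ = J.card * (C_w * (8 * Lp)) := by rw [sum_const, nsmul_eq_mul]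
      _ ≤ (4 * P ^ (6 : ℕ)) * (C_w * (8 * Lp)) := mul_le_mul_of_nonneg_right hcardJ (by positivity)
      _ = 32 * C_w * P ^ (6 : ℕ) * Lp := by ring
  -- sum over characters and moduli
  have hchar : ∀ q' ∈ Finset.Ico 1 ⌊P⌋₊,
      ∑ χ : DirichletCharacter ℂ (q' + 1) with χ.IsPrimitive, ∑ ρ ∈ Z (q' + 1) χ, (zeroOrder χ ρ : ℝ) ≤
        P * (32 * C_w * P ^ (6 : ℕ) * Lp) := by
    intro q' hq'
    have hq : ((q' + 1 : ℕ) : ℝ) ≤ P := by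
      have hq'2 := (Finset.mem_Ico.1 hq').2
      have : ((q' + 1 : ℕ) : ℝ) ≤ ⌊P⌋₊ := by exact_mod_cast hq'2
      exact this.trans hPfloor
    calc ∑ χ : DirichletCharacter ℂ (q' + 1) with χ.IsPrimitive, ∑ ρ ∈ Z (q' + 1) χ, (zeroOrder χ ρ : ℝ)
        ≤ ∑ χ : DirichletCharacter ℂ (q' + 1) with χ.IsPrimitive, 32 * C_w * P ^ (6 : ℕ) * Lp :=
          sum_le_sum fun χ hχ => hper q' hq' χ (mem_filter.1 hχ).2
      _ ≤ ∑ _χ : DirichletCharacter ℂ (q' + 1), 32 * C_w * P ^ (6 : ℕ) * Lp :=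
          sum_le_sum_of_subset_of_nonneg (filter_subset _ _) fun _ _ _ => by positivity
      _ = Fintype.card (DirichletCharacter ℂ (q' + 1)) * (32 * C_w * P ^ (6 : ℕ) * Lp) := by
          rw [sum_const, nsmul_eq_mul, Finset.card_univ]
      _ ≤ P * (32 * C_w * P ^ (6 : ℕ) * Lp) := by
          refine mul_le_mul_of_nonneg_right ?_ (by positivity)
          have := card_dirichletCharacter_le (q' + 1)
          calc (Fintype.card (DirichletCharacter ℂ (q' + 1)) : ℝ) ≤ ((q' + 1 : ℕ) : ℝ) := by exact_mod_cast this
            _ ≤ P := hq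
  calc ∑ q' ∈ Finset.Ico 1 ⌊P⌋₊, ∑ χ : DirichletCharacter ℂ (q' + 1) with χ.IsPrimitive,
        ∑ ρ ∈ Z (q' + 1) χ, (zeroOrder χ ρ : ℝ)
      ≤ ∑ q' ∈ Finset.Ico 1 ⌊P⌋₊, P * (32 * C_w * P ^ (6 : ℕ) * Lp) := sum_le_sum hchar
    _ = (Finset.Ico 1 ⌊P⌋₊).card * (P * (32 * C_w * P ^ (6 : ℕ) * Lp)) := by rw [sum_const, nsmul_eq_mul]
    _ ≤ P * (P * (32 * C_w * P ^ (6 : ℕ) * Lp)) := by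
        refine mul_le_mul_of_nonneg_right ?_ (by positivity)
        rw [Nat.card_Ico]
        have : ((⌊P⌋₊ - 1 : ℕ) : ℝ) ≤ ⌊P⌋₊ := by exact_mod_cast Nat.sub_le _ _
        exact this.trans hPfloor
    _ = 32 * C_w * (P ^ (8 : ℕ) * Lp) := by ring
    _ ≤ 32 * C_w * P ^ (9 : ℕ) := by
        refine mul_le_mul_of_nonneg_left ?_ (by positivity)
        calc P ^ (8 : ℕ) * Lp ≤ P ^ (8 : ℕ) * P := mul_le_mul_of_nonneg_left hLpP (by positivity)
          _ = P ^ (9 : ℕ) := by ring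

/-! ### Théorème 14 for the primitive characters (`χ ≠ χ₀`) -/

open scoped Classical in
/-- **Bombieri's THÉORÈME 14** (*Le grand crible*, §6), in the shape consumed by the tree's
`lemma43_gallagher_of_explicitFormula_of_density` (hypothesis `hZD`): there are absolute
`c_D, C_D > 0` such that for every `P ≥ 2`, all finite sets `Z(q, χ)` of zeros of `L(s, χ)` with
`0 < β < 1`, `|γ| ≤ P^6`, and every `0 ≤ α ≤ 1`,
`∑_{2 ≤ q ≤ P} ∑*_{χ mod q} ∑_{ρ ∈ Z(q,χ), β ≥ α} m(ρ) ≤ C_D P^{c_D(1−α)}`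
("`∑_{q ≤ T} ∑*_χ N(α, T; χ) ≤ c₃ T^{c₂(1−α)}`"). [cite: Bombieri1987GrandCrible, §6 Théorème 14] -/
theorem logFreeDensity_dirichlet :
    ∃ c_D C_D : ℝ, 0 < c_D ∧ 0 < C_D ∧
      ∀ P : ℝ, 2 ≤ P → ∀ Z : (q : ℕ) → DirichletCharacter ℂ q → Finset ℂ,
        (∀ (q' : ℕ) (χ : DirichletCharacter ℂ (q' + 1)), ∀ ρ ∈ Z (q' + 1) χ,
            χ.LFunction ρ = 0 ∧ 0 < ρ.re ∧ ρ.re < 1 ∧ |ρ.im| ≤ P ^ 6) →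
        ∀ α : ℝ, 0 ≤ α → α ≤ 1 →
          ∑ q' ∈ Finset.Ico 1 ⌊P⌋₊, ∑ χ : DirichletCharacter ℂ (q' + 1) with χ.IsPrimitive,
            ∑ ρ ∈ Z (q' + 1) χ with α ≤ ρ.re, (zeroOrder χ ρ : ℝ) ≤ C_D * P ^ (c_D * (1 - α)) := by
  obtain ⟨c₁, hc₁, hsmall⟩ := smallRange
  obtain ⟨δ₀, A, C, hδ₀, hA, hC, hmid⟩ := middleRange hc₁
  obtain ⟨C₃, hC₃, hlarge⟩ := largeRange
  refine ⟨max A (9 / δ₀), max (max 1 C) C₃, by positivity, by positivity, fun P hP Z hZ α hα0 hα1 => ?_⟩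
  have hP1 : 1 ≤ P := by linarith
  have hexp0 : 0 ≤ max A (9 / δ₀) * (1 - α) := mul_nonneg (by positivity) (by linarith)
  have hPpow1 : 1 ≤ P ^ (max A (9 / δ₀) * (1 - α)) := Real.one_le_rpow hP1 hexp0
  have hCD1 : 1 ≤ max (max 1 C) C₃ := (le_max_left _ _).trans' (le_max_left _ _)
  rcases lt_or_ge (1 - α) (c₁ / Real.log P) with h1 | h1
  · -- near `α = 1`
    refine (hsmall P hP Z hZ α h1).trans ?_
    calc (1 : ℝ) ≤ max (max 1 C) C₃ * 1 := by linarith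
      _ ≤ _ := mul_le_mul_of_nonneg_left hPpow1 (by positivity)
  rcases le_or_gt (1 - α) δ₀ with h2 | h2
  · -- the middle range
    refine (hmid P hP Z hZ α h1 h2).trans ?_
    refine mul_le_mul ((le_max_right _ _).trans (le_max_left _ _)) ?_ (by positivity) (by positivity)
    exact Real.rpow_le_rpow_of_exponent_le hP1 (mul_le_mul_of_nonneg_right (le_max_left _ _) (by linarith))
  · -- the trivial range
    have hsub : ∑ q' ∈ Finset.Ico 1 ⌊P⌋₊, ∑ χ : DirichletCharacter ℂ (q' + 1) with χ.IsPrimitive,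
        ∑ ρ ∈ Z (q' + 1) χ with α ≤ ρ.re, (zeroOrder χ ρ : ℝ) ≤
        ∑ q' ∈ Finset.Ico 1 ⌊P⌋₊, ∑ χ : DirichletCharacter ℂ (q' + 1) with χ.IsPrimitive,
          ∑ ρ ∈ Z (q' + 1) χ, (zeroOrder χ ρ : ℝ) :=
      sum_le_sum fun q' _ => sum_le_sum fun χ _ =>
        sum_le_sum_of_subset_of_nonneg (filter_subset _ _) fun ρ _ _ => Nat.cast_nonneg _
    refine hsub.trans ((hlarge P hP Z hZ).trans ?_)
    refine mul_le_mul (le_max_right _ _) ?_ (by positivity) (by positivity)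
    rw [← Real.rpow_natCast]
    refine Real.rpow_le_rpow_of_exponent_le hP1 ?_
    push_cast
    have : (9 : ℝ) ≤ 9 / δ₀ * (1 - α) := by
      rw [div_mul_eq_mul_div, le_div_iff₀ hδ₀]; nlinarith
    exact this.trans (mul_le_mul_of_nonneg_right (le_max_right _ _) (by linarith))

end Literature.NumberTheory.LFunctions.LogFreeDensity
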